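/-
Copyright: statement-level skeleton of a published paper (lit-balaban cell, Phase-2 proof seat p40 gen 71). No proof claims
beyond what the kernel checks below.
-/
import Literature.MathematicalPhysics.QuantumFieldTheory.Balaban1983to89.B3Bound316ZeroLattice

/-!
# B3 — T. Bałaban, *(Higgs)₂,₃ quantum fields in a finite volume. III. Renormalization*, CMP **88** (1983) 411–445
[Balaban1983Higgs3], p. 439 [PDF 29], **(3.23)–(3.24) ON THE PRINT'S OWN CARRIER**: the square bracket of (3.23) for the
INFINITE-LATTICE zero-field propagator `G_{j″}(0) = G_{j″}(ηℤ³, 0)` — the p. 439 splitting of `g′`, *"the expression in the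
square bracket in (3.23) containing the second term will be convergent"*, *"Rescaling from the η-lattice to the
L^{−j″}-lattice"* as an identity, *"using the same method as in (3.16) we get some convergent expressions plus
q²g(x)g′(x)Σ_{x′}ξ^d(∂^ξ_μC^ξ)(x − x′)C^ξ(x − x′)"*, the (3.24) sum bounded uniformly in the spacing (its position-space
symmetrisation `Σ(∂C)C = −(ξ⁴/2)Σ(∂C)²` on `ℤ³` and p03's momentum-integral form of (3.24) by name), the summation *"over
proper orderings and j-indices"*, and the conclusion *"Hence the last graph in (3.22) defines a vertex with some convergent
function"*: `|(3.23)| ≤ (C₁ + C₂K′)·Σ_μΣ_x ξ³‖φ(x)‖‖q²(∂^ξ_μφ′)(x)‖` uniformly in the step `j″` and the window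

statement-level skeleton of published theorems with citation tags; proofs where landed; nothing here is a claim about
the Yang–Mills mass gap

PDF held: `paper:balaban1983-higgs-2-3-quantum-fields-finite-volume` (journal page = PDF page + 410); pp. 437–439 [PDF 27–29]
read in the OCR text (`p0027.txt`–`p0029.txt` of `lit read`) and (3.22)–(3.25) on the ×2 render
`run/shared/lean/pub/pub-balaban/b2b-balaban-ref1/pages/1983-cmp88-higgs23-III/1983-cmp88-higgs23-III-p029-x2.png`.

CITATION HEADER (lean-in-tree rule).  Part of the lit-balaban TYPED SKELETON (HOME `run/shared/lean/pub/lit-balaban/`), Phase 2,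
proof seat p40 generation 71.  Row **B3.Eq3.21-3.24** of `HOME/lit-balaban-r15/ROWS-B3.md` (fold owner r15), the owner's named
residual (iii) of the row (r15 g14, 2026-08-23): *"(3.22)/(3.23) WITH BODIES ON PRINT'S CARRIER ηℤ^d for G_{j″}(0) = G(ηℤ³,0)"*
— the torus readings exist (r15's `B3Sect3ScalarSelfEnergy.bracket323`/`expr323` under kernel hypotheses, p39 g5 `B3Bound323`
(second term), `B3Eq324Torus` ((3.24) on the torus), `B3Bound323ZeroTorus` (the zero-field torus instance `G0xi`), p39 g6
`B3Eq323CrossTermsZeroTorus` (the cross terms and the whole bracket for `G0xi`), p20 g6 `B3Eq323EtaZeroTorus` (the rescaling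
sentence on the torus)); THIS FILE is their twin ON THE PRINTED INFINITE LATTICE, the companion of this seat's
`B3Eq322ZeroLattice` ((3.21)/(3.22) on `ℤ^{d+1}`) and the literal twin, display for display, of p39 g17's
`B3Bound316ZeroLattice` ((3.15)/(3.16) on `ξℤ³`), on whose lattice files it is built BY NAME — p39's
`B3Eq316ResolventZeroLattice` (`GxiL` = `G^ξ_k(0)`, `MxiL` = `G^ξ_k(0) − C^ξ`, `xiOf`), `B3Eq316DifferenceKernelBounds` (`prof`,
`dK1`, `exists_bounds`: the printed kernel laws with one rate, `|M| ≤ K`, and the transposed Fubini bound for `(∂_μM)(y,·)`),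
`B3ZdLatticeProfileSums`/`B3ZdKernelConvolutions` (`sum_radial_le`, `tsum_profile_le`, `tsum_profile_shift_le`,
`tsum_exp_supNorm_le`), `B3Eq330EtaZeroLattice` (`GetaL`, `scale330`: the `η`-lattice reading), `B3Bound316ZeroLattice`
(`prof_one_mul_dist_le_one`, `exp_shift_le`, `pieceXi`, `sum_pieceXi` = (2.6), `exists_pieceXi_exp` = (2.10)), and r15/p03's
`B3Sect3VectorSelfEnergy.Eq324`/`B3Eq324Parseval.eq324_holds` ((3.24) as the momentum integral, PROVED on `ξℤ^d`).  Nothing of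
theirs is restated.

THE PRINTED TEXT (p. 439 [PDF 29], verbatim).  *"(3.22) The first graph on the right side has positive degree, the second is
treated in the same way as the expression (3.15): we sum over proper orderings and j-indices and we get
  Σ_{μ=1}^d Σ_x η^dφ(x)·[q²Σ_{x′}η^d(∂^η_μG^η_{j″}(0))(x,x′)g(x)G^η_{j″}(x,x′)g′(x′)](∂^η_μφ′)(x).   (3.23)
Further if we take g′(x′) = g′(x) + ((g′(x′) − g′(x))/|x′ − x|)|x′ − x|, then the expression in the square bracket in (3.23)
containing the second term will be convergent and the expression with the first term is equal to
q²g(x)g′(x)Σ_{x′}η^d(∂^η_μG^η_{j″}(0))(x,x′)G^η_{j″}(x,x′). Rescaling from the η-lattice to the L^{−j″}-lattice and using the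
same method as in (3.16) we get some convergent expressions plus q²g(x)g′(x)Σ_{x′}ξ^d(∂^ξ_μC^ξ)(x − x′)C^ξ(x − x′). We have further
  Σ_{x′}ξ^d(∂^ξ_μC^ξ)(x−x′)C^ξ(x−x′) = (2π)^{−d}∫_{|p|≤π/ξ}dp ∂^ξ_μ(p)/(Δ^ξ(p)+1)² = (2π)^{−d}∫_{|p′|≤π}dp′ (cos p′_μ − 1)/(Δ¹(p′)+ξ²)²·ξ^{3−d},
  (3.24)
and the expression on the right side has a finite limit as ξ → 0. Hence the last graph in (3.22) defines a vertex with some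
convergent function."*  With p. 437 (*"the same method as in (3.16)"*): *"Next we replace G^ξ_{j″}(0) by C^ξ = (−Δ^ξ + 1)^{−1}:
G^ξ_{j″}(0) = C^ξ + G^ξ_{j″}(0)(1 − m²_{j″} − a_{j″}P_{j″})C^ξ. … Using the inequalities |C^ξ(y − y′)| ≦ O(1)e^{−½|y−y′|}/|y − y′|,
|G^ξ_{j″}(0; y, y′)| ≦ O(1)e^{−δ₀|y−y′|}/|y − y′|, and the corresponding inequalities for derivatives, we can estimate (3.16) by a
constant."*, and p. 433: *"Finally we replace the scalar field propagator G_k(□,0) by G_k(0)"* — `G_k(0)` is the propagator of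
the infinite lattice `ηℤ^d`, zero external field.

WHAT IS PROVED, and how (`d = 3`; `ℤ³ = ZSite 3` integer labels, spacing `ξ = L^{−k}` = `xiOf ℓ k`, `L = ℓ + 1 ≥ 2`, `k = j″`;
kernels w.r.t. the volume element `Σ ξ³`; `(∂^ξ_μK)(y,y′)` = `dK1 ξ μ K y y′`; `P_q^δ(u) = (ξ·max(1,|u|_∞))^{−q}e^{−δξ|u|_∞}` =
`prof ξ δ q u`).
* §1 THE OBJECTS ON `ℤ³`: the summand `term323` and the series `bracket323L` (= r15's torus `bracket323` with `Σ_{y′∈T}` replaced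
  by `Σ'_{y′∈ℤ³}`), the printed first term `first323L(y) = Σ'_{y′}ξ³(∂^ξ_μG0)(y,y′)G(y,y′)` and second term `second323L` (factor
  `g(y)(g′(y′) − g′(y))`), the (3.24) sum `cc324 ξ μ C x = Σ'_{x′}ξ³(∂^ξ_μC)(x−x′)C(x−x′)` for a convolution kernel, and the
  expression `expr323L` = (3.23) for a leg `φ` supported in a finite set `S`.
* §2 THE p. 439 SPLITTING *"if we take g′(x′) = g′(x) + (g′(x′) − g′(x))…"*: `term323_split` (pointwise, model-free) and
  `bracket323L_split`: `[(3.23)](y) = g(y)g′(y)·first323L(y) + second323L(y)` whenever both series converge.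
* §3 *"THE EXPRESSION … CONTAINING THE SECOND TERM WILL BE CONVERGENT"* (model-free form): under the printed laws
  `|(∂^ξ_μG0)(y,y′)| ≤ A·P₂^δ(y−y′)`, `|G(y,y′)| ≤ B·P₁^δ(y−y′)`, `|g| ≤ 1` and `g′` LIPSCHITZ, `|g′(y′) − g′(y)| ≤ K′·ξ|y − y′|_∞`
  (the reading of the printed insertion `(g′(x′) − g′(x))/|x′ − x| · |x′ − x|`, as in p39's `B3Bound323`):
  `abs_secondTerm323_le` — `|summand| ≤ A·B·K′·ξ³P₂^δ(y−y′)` (THE DISTANCE CANCELS ONE POWER OF THE SINGULARITY,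
  `prof_one_mul_dist_le_one`) — and **`abs_second323L_le`**: the series converges absolutely and `|second323L(y)| ≤ A·B·K′·833/δ³`
  for every `y`, a constant independent of `0 < ξ ≤ 1` (`tsum_profile_shift_le`, `q = 2`).
* §4 *"USING THE SAME METHOD AS IN (3.16) WE GET SOME CONVERGENT EXPRESSIONS PLUS q²g(x)g′(x)Σ_{x′}ξ^d(∂^ξ_μC^ξ)(x−x′)C^ξ(x−x′)"*:
  `firstTerm323_split` (model-free: with `G0 = C^ξ + M0`, `G = C^ξ + M` pointwise the first-term summand is
  `ξ³(∂C)(y−y′)C(y−y′) + ξ³(∂C)(y−y′)M(y,y′) + ξ³(∂M0)(y,y′)G(y,y′)`), and for the print's propagator **`first323L_GxiL_split`**: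
  `first323L[G^ξ_k(0),G^ξ_k(0)](y) = cc324 ξ μ C^ξ y + Σ'ξ³(∂^ξ_μC^ξ)(y−y′)M(y,y′) + Σ'ξ³(∂^ξ_μM)(y,y′)G^ξ_k(0)(y,y′)` with all three
  series convergent, HYPOTHESIS-FREE for every `k ≥ 1`, `0 < a`, `0 ≤ m²` (`M = MxiL`, the resolvent identity preceding (3.16)).
* §5 **(3.24) ON `ℤ³`**: `tsum_pdiffZ_mul_self` — for every square-summable convolution kernel `C`,
  `Σ'_uξ³(∂^ξ_μC)(u)C(u) = −(ξ⁴/2)Σ'_u((∂^ξ_μC)(u))²` (the position-space content of the printed symmetrisation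
  `∂^ξ_μ(p) ↦ ξ^{−1}(cos ξp_μ − 1) = −(ξ/2)|ξ^{−1}(e^{iξp_μ} − 1)|²` inside (3.24); p39's torus `B3Eq324Torus.sum_d1Kernel_mul_self`
  on `ℤ³`); `cc324_eq_tsum` (the substitution `u = x − x′`); **`abs_cc324_le`**: under `|(∂^ξ_μC)(u)| ≤ A·P₂^δ(u)` the (3.24)
  sum is `≤ 0` and `|cc324 ξ μ C x| ≤ (53/2)·A²` FOR EVERY `ξ > 0` (`Σ_{u∈ℤ³}max(1,|u|_∞)^{−4} ≤ 53` by `sum_radial_le`) — the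
  uniform bound that the text draws from *"the expression on the right side has a finite limit as ξ → 0"*; and the DICTIONARY
  `cc324_Cxi_eq_integral`: for `C = C^ξ` the sum IS the printed momentum integral `(2π)^{−3}∫_{|p|≤π/ξ}ξ^{−1}(cos ξp_μ − 1)/(Δ^ξ(p)+1)²dp`
  (p03's `B3Eq324Parseval.eq324_holds`, first equality of (3.24), by name).
* §6 THE PRINT'S PROPAGATOR, *"SOME CONVERGENT EXPRESSIONS"*: **`exists_pieces323_bound`** — there are `0 < δ ≤ 1`, `C ≥ 1`,
  `Cst > 0` (functions of `L` and the window `[a₋,a₊] × [0,m²₊]` only) such that for EVERY `k ≥ 1` and window point the laws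
  `|G^ξ_k(0)| ≤ C·P₁^δ`, `|∂^ξ_μG^ξ_k(0)| ≤ C·P₂^δ` hold and, for all `μ, y`, each of the three series of §4 converges with
  absolute value `≤ Cst` (the `C^ξC^ξ` term by §5 with `Σ'(C^ξ)² < ∞` from `|C^ξ| ≤ C·P₁^δ`; the `(∂C^ξ)·M` term by `|M| ≤ K` and
  `Σ_{y′}ξ³P₂^δ ≤ 833/δ³`; the `(∂M)·G^ξ_k(0)` term by p39's transposed Fubini bound); **`exists_first323L_GxiL_bound`**:
  `|first323L[G^ξ_k(0),G^ξ_k(0)](y)| ≤ Cst′` uniformly; **`exists_bracket323L_GxiL_bound`**: `∃ C₁ C₂ > 0` with, for every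
  `k ≥ 1`, window point, `K′ ≥ 0`, `|g|,|g′| ≤ 1`, `g′` `K′`-Lipschitz, `μ`, `y`: the (3.23) series converges,
  `|second323L(y)| ≤ C₂K′`, the splitting holds and `|[(3.23)](y)| ≤ C₁ + C₂K′` — BOTH propagator slots the zero-field
  `G^ξ_{j″}(0)` (at zero field the second slot has the same kernel), NO kernel hypothesis left.
* §7 THE RESCALING SENTENCE: `dK1_rescale`, `term323_rescale`/`bracket323L_rescale` (model-free: `η = rξ`, both kernels
  `↦ r^{−d+2}· = r^{−1}·`; `η³·r^{−2}·r^{−1} = ξ³`, exact in `d = 3` — p20's torus `bracket323_rescale_three`) and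
  **`bracket323L_eta_eq`**: the bracket built on the `η = L^{−k}` lattice from `G^η_{j″}(0) = GetaL ℓ j″ k` equals the bracket
  built on the `ξ = L^{−j″}` lattice from `G^ξ_{j″}(0) = GxiL ℓ j″`; `lipschitz_eta_to_xi` (a `g′` that is `K′`-Lipschitz for the
  `η`-distance is `K′`-Lipschitz for the `ξ`-distance, `L^{j″}η ≤ 1`); **`exists_bracket323L_eta_bound`**: the `η`-lattice
  vertex coefficient is `≤ C₁ + C₂K′` uniformly in `k ≥ j″ ≥ 1`.
* §8 *"WE SUM OVER PROPER ORDERINGS AND j-INDICES AND WE GET (3.23)"*: `dK1_finset_sum`, `term323_sum_sum`/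
  **`bracket323L_sum_sum`** (bilinearity in the two propagators, model-free, under convergence of the piece series),
  `abs_dK1_le_of_exp`/`summable_term323_of_exp` (convergence for exponentially decaying kernels — the (2.10) class) and
  **`bracket323L_GxiL_eq_sum_pieces`**: `[(3.23)](G^ξ_k(0),G^ξ_k(0)) = Σ_{j<k}Σ_{j′<k}[(3.23)](G^ξ_{(j)}(0),G^ξ_{(j′)}(0))`
  (p39's `pieceXi`, (2.6) `sum_pieceXi`, (2.10) `exists_pieceXi_exp`), every `k ≥ 1`, `0 < a`, `0 ≤ m²`, `|g|,|g′| ≤ 1`.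
* §9 *"HENCE THE LAST GRAPH IN (3.22) DEFINES A VERTEX WITH SOME CONVERGENT FUNCTION"*: `abs_expr323L_le` (model-free) and
  **`exists_expr323L_GxiL_bound`** — `|(3.23)[G^ξ_{j″}(0),G^ξ_{j″}(0)]| ≤ (C₁ + C₂K′)·Σ_μΣ_{y∈S}ξ³‖φ(y)‖‖q²D_μ(y)‖` for every
  `k = j″ ≥ 1`, window point, localizations and Lipschitz constant, leg `φ`, `D` (in (3.23): `D_μ = ∂^ξ_μφ′`) and charge matrix
  `q`: a local vertex with a bounded coefficient, ON THE PRINT'S CARRIER (the zero-field infinite lattice).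
HONEST SCOPE: `d = 3` (the dimension in which p. 437 writes the laws `O(1)e^{−½|y−y′|}/|y−y′|` and in which the rescaling is
exact; the model-free §§1–2, 4–5, 7–8 are written on `ℤ³` because the carriers `GxiL`, `prof`, `pieceXi` are); zero external
field, unit blocks, `U ≡ 1` — the printed case after the p. 433 reductions; BOTH propagators of (3.23) instantiated with the
zero-field scalar `G^ξ_k(0)` in the hypothesis-free corollaries (as in p39's torus `B3Eq323CrossTermsZeroTorus` and lattice
`B3Bound316ZeroLattice`; the general second slot is kept in the model-free §§2–4); the Lipschitz form of `g′` with the sup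
distance is the stated reading of the printed insertion; the summation *"over proper orderings and j-indices"* is taken
literally over `[0, j″)²` with `G_{j″}(0) = Σ_{j<j″}G_{(j)}(0)` ((2.6); the admissibility bookkeeping of orderings, row B3.Eq2.7,
is not re-derived — as in p20's `B3Resummation315` and p39's `bracket315L_GxiL_eq_sum_pieces`); constants existential (the `53/2`
and `833/δ³` are the only explicit ones); the LIMIT statement of (3.24) (*"has a finite limit as ξ → 0"*) is not typed — what the
conclusion uses, boundedness uniformly in `ξ`, is (`abs_cc324_le`), and the momentum-integral FORM of (3.24) is p03's theorem,
cited by name.  D-SCOPE PER DISPLAY: the splitting, the (3.16)-replacement algebra, the symmetrisation identity of §5 and the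
bilinearity of §8 are dimension-free algebra typed on `ℤ³`; the rescaling sentence carries the factor `(L^{j″}η)^{3−d}` in
dimension `d` (`η^d·η^{−1}·r^{−2(d−2)}` against `ξ^d·ξ^{−1}`), so it is EXACT in `d = 3` (§7) and has the extra small factor
`L^{j″}η ≤ 1` in `d = 2`; the bounds of §§3, 5, 6 are PROVED in `d = 3`; the `d = 2` twin is the same text with the `d = 2` laws
(logarithmic propagator singularity, `Σξ²(…)` Riemann sums; (3.24) carries `ξ^{3−d} = ξ` and tends to `0`), genuinely easier, NOT
typed here because the lattice-sum toolkit (`tsum_profile_le`, the `GxiL` laws) is written for `ℤ³`.  NOT claimed: the pictures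
of (3.22) as graph objects and the positive-degree first graph of (3.22) (this seat's `B3Eq322ZeroLattice`, the `ℤ^{d+1}` twin of
p18's `B3Eq322PositiveDegree`, in review — a one-line dictionary `bracket323L ↔ bracket323Z` once it lands), `d = 2`, non-zero
backgrounds, numerical values of `C₁, C₂`.  Mathlib + the cited tree files only; definitions with bodies and theorems, no named
facts (`… : Prop`), no sorry; standard axioms (`#print axioms` on `exists_expr323L_GxiL_bound`, `bracket323L_GxiL_eq_sum_pieces`,
`exists_bracket323L_eta_bound`, `cc324_Cxi_eq_integral`: propext, Classical.choice, Quot.sound).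
Unit `lit-balaban-p40-g71` (Phase-2 proof seat p40, gen 71), HOME `run/shared/lean/pub/lit-balaban/`, 2026-08-23.
-/

open scoped BigOperators RealInnerProductSpace
open Finset

namespace Literature.MathematicalPhysics.QuantumFieldTheory.Balaban1983to89.B3Eq323ZeroLattice

open B3Sect3VectorSelfEnergy (ZSite unitVec pdiffZ Cxi bzBox lapSymbol)
open B3CxiUniformBound (supNorm le_supNorm)
open B3Eq316ResolventZeroLattice (xiOf GxiL MxiL xiOf_pos xiOf_le_one)
open B3Eq316DifferenceKernelBounds (prof dK1 prof_nonneg prof_sub_comm prof_mono_rate exists_bounds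
  abs_tsum_le_tsum_of_abs_le)
open B3ZdKernelConvolutions (tsum_profile_shift_le profile_le_inv_pow)
open B3ZdLatticeProfileSums (sum_radial_le tsum_profile_le tsum_exp_supNorm_le)
open B3Eq330EtaZeroLattice (scale330 GetaL scale330_pos scale330_le_one xiOf_eq_scale_mul GetaL_eq)
open B3Bound316ZeroLattice (prof_one_mul_dist_le_one prof_pos exp_shift_le pieceXi sum_pieceXi exists_pieceXi_exp)

noncomputable section

/-! ## §1 The objects of (3.23)/(3.24) on the infinite lattice `ξℤ³` -/

section Defs

variable {W : Type*} [NormedAddCommGroup W] [InnerProductSpace ℝ W]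

/-- the summand of the printed FIRST TERM of p. 439 at `(y, y′)` on `ξℤ³` (volume element `ξ³`), without `q²g(x)g′(x)`:
`ξ³·(∂^ξ_μG^ξ_{j″}(0))(y,y′)·G^ξ_{j″}(y,y′)` (`G0` = `G^ξ_{j″}(0)`, `G` = `G^ξ_{j″}`). [cite: Balaban1983Higgs3, (3.23) p.439] -/
def firstTerm323 (ξ : ℝ) (μ : Fin 3) (G0 G : ZSite 3 → ZSite 3 → ℝ) (y y' : ZSite 3) : ℝ :=
  ξ ^ 3 * (dK1 ξ μ G0 y y' * G y y')

/-- **THE FIRST TERM OF THE p. 439 SPLITTING ON THE INFINITE LATTICE**, verbatim: *"the expression with the first term is equal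
to q²g(x)g′(x)Σ_{x′}η^d(∂^η_μG^η_{j″}(0))(x,x′)G^η_{j″}(x,x′)"* without `q²g(x)g′(x)`: `Σ'_{y′}ξ³(∂^ξ_μG0)(y,y′)G(y,y′)`.
[cite: Balaban1983Higgs3, (3.23) p.439] -/
def first323L (ξ : ℝ) (μ : Fin 3) (G0 G : ZSite 3 → ZSite 3 → ℝ) (y : ZSite 3) : ℝ :=
  ∑' y', firstTerm323 ξ μ G0 G y y'

/-- the summand of the square bracket of **(3.23)** p. 439 at `(y, y′)` on `ξℤ³` without `q²`:
`ξ³·(∂^ξ_μG^ξ_{j″}(0))(y,y′)g(y)G^ξ_{j″}(y,y′)g′(y′)`. [cite: Balaban1983Higgs3, (3.23) p.439] -/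
def term323 (ξ : ℝ) (μ : Fin 3) (G0 G : ZSite 3 → ZSite 3 → ℝ) (g g' : ZSite 3 → ℝ) (y y' : ZSite 3) : ℝ :=
  ξ ^ 3 * (dK1 ξ μ G0 y y' * g y * G y y' * g' y')

/-- **THE SQUARE BRACKET OF (3.23) ON THE INFINITE LATTICE** (p. 439 [PDF 29]), verbatim:
*"[q²Σ_{x′}η^d(∂^η_μG^η_{j″}(0))(x,x′)g(x)G^η_{j″}(x,x′)g′(x′)]"* without `q²`: `Σ'_{y′}ξ³(∂^ξ_μG0)(y,y′)g(y)G(y,y′)g′(y′)` — r15's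
torus `B3Sect3ScalarSelfEnergy.bracket323` with the finite torus sum replaced by the series over `ℤ³`.
[cite: Balaban1983Higgs3, (3.23) p.439] -/
def bracket323L (ξ : ℝ) (μ : Fin 3) (G0 G : ZSite 3 → ZSite 3 → ℝ) (g g' : ZSite 3 → ℝ) (y : ZSite 3) : ℝ :=
  ∑' y', term323 ξ μ G0 G g g' y y'

/-- the summand of the printed SECOND TERM of p. 439 (the insertion `(g′(x′) − g′(x))/|x′−x| · |x′−x|` = `g′(y′) − g′(y)`):
`ξ³·(∂^ξ_μG0)(y,y′)g(y)G(y,y′)(g′(y′) − g′(y))`. [cite: Balaban1983Higgs3, (3.23) p.439] -/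
def secondTerm323 (ξ : ℝ) (μ : Fin 3) (G0 G : ZSite 3 → ZSite 3 → ℝ) (g g' : ZSite 3 → ℝ) (y y' : ZSite 3) : ℝ :=
  ξ ^ 3 * (dK1 ξ μ G0 y y' * g y * G y y' * (g' y' - g' y))

/-- **THE SECOND TERM OF THE p. 439 SPLITTING ON THE INFINITE LATTICE** (*"the expression in the square bracket in (3.23)
containing the second term"*): `Σ'_{y′}ξ³(∂^ξ_μG0)(y,y′)g(y)G(y,y′)(g′(y′) − g′(y))`. [cite: Balaban1983Higgs3, (3.23) p.439] -/
def second323L (ξ : ℝ) (μ : Fin 3) (G0 G : ZSite 3 → ZSite 3 → ℝ) (g g' : ZSite 3 → ℝ) (y : ZSite 3) : ℝ :=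
  ∑' y', secondTerm323 ξ μ G0 G g g' y y'

/-- **THE LEFT SIDE OF (3.24)** p. 439 for a convolution kernel `C` on `ξℤ³`: `Σ'_{x′}ξ³(∂^ξ_μC)(x − x′)C(x − x′)` — for
`C = C^ξ` (`Cxi 3 ξ`) literally the left member of r15's `B3Sect3VectorSelfEnergy.Eq324 3 ξ μ x`. [cite: Balaban1983Higgs3, (3.24) p.439] -/
def cc324 (ξ : ℝ) (μ : Fin 3) (C : ZSite 3 → ℝ) (x : ZSite 3) : ℝ :=
  ∑' x', ξ ^ 3 * (pdiffZ ξ⁻¹ μ C (x - x') * C (x - x'))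

/-- **(3.23)** p. 439 [PDF 29] ON THE INFINITE LATTICE, verbatim: *"we get Σ_{μ=1}^d Σ_x η^dφ(x)·[q²Σ_{x′}η^d(∂^η_μG^η_{j″}(0))(x,x′)
g(x)G^η_{j″}(x,x′)g′(x′)](∂^η_μφ′)(x). (3.23)"*: `Σ_μΣ_{y∈S}ξ³φ(y)·[bracket]q²D_μ(y)` for a localized leg `φ` supported in the
finite set `S` (`D μ` = `∂^ξ_μφ′`; the bracket is scalar, `q²` acts on the leg as in r15's `expr323`).
[cite: Balaban1983Higgs3, (3.23) p.439] -/
def expr323L (ξ : ℝ) (q : W →ₗ[ℝ] W) (G0 G : ZSite 3 → ZSite 3 → ℝ) (g g' : ZSite 3 → ℝ)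
    (S : Finset (ZSite 3)) (φ : ZSite 3 → W) (D : Fin 3 → ZSite 3 → W) : ℝ :=
  ∑ μ : Fin 3, ∑ y ∈ S, ξ ^ 3 * (bracket323L ξ μ G0 G g g' y * ⟪φ y, q (q (D μ y))⟫)

end Defs

/-! ## §2 The p. 439 splitting of `g′` -/

section Split

variable {ξ : ℝ} {μ : Fin 3} {G0 G : ZSite 3 → ZSite 3 → ℝ} {g g' : ZSite 3 → ℝ}

/-- **"IF WE TAKE g′(x′) = g′(x) + ((g′(x′) − g′(x))/|x′ − x|)|x′ − x|"** (p. 439), summand by summand, model-free: the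
(3.23)-summand is `g(y)g′(y)`× the first-term summand plus the second-term summand. [cite: Balaban1983Higgs3, (3.23) p.439] -/
theorem term323_split (ξ : ℝ) (μ : Fin 3) (G0 G : ZSite 3 → ZSite 3 → ℝ) (g g' : ZSite 3 → ℝ) (y y' : ZSite 3) :
    term323 ξ μ G0 G g g' y y' =
      g y * g' y * firstTerm323 ξ μ G0 G y y' + secondTerm323 ξ μ G0 G g g' y y' := by
  unfold term323 firstTerm323 secondTerm323
  ring

/-- kernel: the second-term summand vanishes on the diagonal (`g′(y) − g′(y) = 0`). [cite: Balaban1983Higgs3, (3.23) p.439] -/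
theorem secondTerm323_self (ξ : ℝ) (μ : Fin 3) (G0 G : ZSite 3 → ZSite 3 → ℝ) (g g' : ZSite 3 → ℝ) (y : ZSite 3) :
    secondTerm323 ξ μ G0 G g g' y y = 0 := by
  simp [secondTerm323]

/-- **THE p. 439 SPLITTING OF THE SQUARE BRACKET OF (3.23) ON `ξℤ³`** (model-free): whenever the first-term and second-term
series converge, the (3.23) series converges and `[(3.23)](y) = g(y)g′(y)·first323L(y) + second323L(y)`.
[cite: Balaban1983Higgs3, (3.23) p.439] -/
theorem bracket323L_split {y : ZSite 3} (h1 : Summable (firstTerm323 ξ μ G0 G y))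
    (h2 : Summable (secondTerm323 ξ μ G0 G g g' y)) :
    Summable (term323 ξ μ G0 G g g' y) ∧
      bracket323L ξ μ G0 G g g' y = g y * g' y * first323L ξ μ G0 G y + second323L ξ μ G0 G g g' y := by
  have e : term323 ξ μ G0 G g g' y =
      fun y' => g y * g' y * firstTerm323 ξ μ G0 G y y' + secondTerm323 ξ μ G0 G g g' y y' :=
    funext fun y' => term323_split ξ μ G0 G g g' y y'
  refine ⟨by rw [e]; exact (h1.mul_left _).add h2, ?_⟩
  unfold bracket323L first323L second323L
  rw [e, (h1.mul_left _).tsum_add h2, tsum_mul_left]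

end Split

/-! ## §3 *"The expression in the square bracket in (3.23) containing the second term will be convergent"* -/

section Second

variable {ξ δ : ℝ} {μ : Fin 3} {G0 G : ZSite 3 → ZSite 3 → ℝ} {g g' : ZSite 3 → ℝ} {A B K' : ℝ}

/-- **THE SECOND-TERM SUMMAND UNDER THE PRINTED LAWS**: with one rate `δ` for *"|G^ξ_{j″}(0; y, y′)| ≦ O(1)e^{−δ₀|y−y′|}/|y − y′|
… and the corresponding inequalities for derivatives"* — `|(∂^ξ_μG0)(y,y′)| ≤ A·P₂^δ(y−y′)`, `|G(y,y′)| ≤ B·P₁^δ(y−y′)` —, `|g| ≤ 1`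
and `g′` `K′`-Lipschitz for the physical sup distance, `|g′(y′) − g′(y)| ≤ K′·ξ|y − y′|_∞`:
`|secondTerm323(y,y′)| ≤ A·B·K′·ξ³P₂^δ(y − y′)` — the distance `|x′ − x|` cancels one power of the singularity `1/|y−y′|³` of
`(∂G(0))·G` (`P₁^δ(u)·ξ|u|_∞ ≤ 1`). [cite: Balaban1983Higgs3, (3.23) p.439] -/
theorem abs_secondTerm323_le (hξ : 0 < ξ) (hδ : 0 ≤ δ) (hK' : 0 ≤ K')
    (hD : ∀ y y', |dK1 ξ μ G0 y y'| ≤ A * prof ξ δ 2 (y - y'))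
    (hG : ∀ y y', |G y y'| ≤ B * prof ξ δ 1 (y - y')) (hg : ∀ x, |g x| ≤ 1)
    (hlip : ∀ y y', |g' y' - g' y| ≤ K' * (ξ * (supNorm (y - y') : ℝ))) (y y' : ZSite 3) :
    |secondTerm323 ξ μ G0 G g g' y y'| ≤ A * B * K' * (ξ ^ 3 * prof ξ δ 2 (y - y')) := by
  have hP1 : 0 < prof ξ δ 1 (y - y') := prof_pos hξ δ 1 _
  have hP2 : 0 < prof ξ δ 2 (y - y') := prof_pos hξ δ 2 _
  have hAP : 0 ≤ A * prof ξ δ 2 (y - y') := (abs_nonneg _).trans (hD y y')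
  have hBP : 0 ≤ B * prof ξ δ 1 (y - y') := (abs_nonneg _).trans (hG y y')
  have hA : 0 ≤ A := le_of_mul_le_mul_right (by rwa [zero_mul]) hP2
  have hB : 0 ≤ B := le_of_mul_le_mul_right (by rwa [zero_mul]) hP1
  have hn : (0 : ℝ) ≤ (supNorm (y - y') : ℝ) := Nat.cast_nonneg _
  have h12 : |dK1 ξ μ G0 y y'| * |g y| ≤ A * prof ξ δ 2 (y - y') * 1 :=
    mul_le_mul (hD y y') (hg y) (abs_nonneg _) hAP
  have h123 : |dK1 ξ μ G0 y y'| * |g y| * |G y y'| ≤ A * prof ξ δ 2 (y - y') * 1 * (B * prof ξ δ 1 (y - y')) :=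
    mul_le_mul h12 (hG y y') (abs_nonneg _) (by rw [mul_one]; exact hAP)
  have h1234 : |dK1 ξ μ G0 y y'| * |g y| * |G y y'| * |g' y' - g' y| ≤
      A * prof ξ δ 2 (y - y') * 1 * (B * prof ξ δ 1 (y - y')) * (K' * (ξ * (supNorm (y - y') : ℝ))) :=
    mul_le_mul h123 (hlip y y') (abs_nonneg _) (by rw [mul_one]; exact mul_nonneg hAP hBP)
  have hkey : prof ξ δ 1 (y - y') * (ξ * (supNorm (y - y') : ℝ)) ≤ 1 := prof_one_mul_dist_le_one hξ hδ (y - y')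
  unfold secondTerm323
  rw [abs_mul, abs_of_pos (pow_pos hξ 3), abs_mul, abs_mul, abs_mul]
  calc ξ ^ 3 * (|dK1 ξ μ G0 y y'| * |g y| * |G y y'| * |g' y' - g' y|)
      ≤ ξ ^ 3 * (A * prof ξ δ 2 (y - y') * 1 * (B * prof ξ δ 1 (y - y')) * (K' * (ξ * (supNorm (y - y') : ℝ)))) :=
        mul_le_mul_of_nonneg_left h1234 (pow_pos hξ 3).le
    _ = A * B * K' * (ξ ^ 3 * prof ξ δ 2 (y - y')) * (prof ξ δ 1 (y - y') * (ξ * (supNorm (y - y') : ℝ))) := by ring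
    _ ≤ A * B * K' * (ξ ^ 3 * prof ξ δ 2 (y - y')) * 1 :=
        mul_le_mul_of_nonneg_left hkey
          (mul_nonneg (mul_nonneg (mul_nonneg hA hB) hK') (mul_pos (pow_pos hξ 3) hP2).le)
    _ = A * B * K' * (ξ ^ 3 * prof ξ δ 2 (y - y')) := mul_one _

/-- **"THE EXPRESSION IN THE SQUARE BRACKET IN (3.23) CONTAINING THE SECOND TERM WILL BE CONVERGENT" ON THE INFINITE LATTICE**
(model-free form): under the printed kernel laws with one rate `0 < δ ≤ 1`, `0 < ξ ≤ 1`, `|g| ≤ 1` and `g′` `K′`-Lipschitz, the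
second-term series converges absolutely and `|second323L(y)| ≤ A·B·K′·833/δ³` for EVERY `y` — a constant independent of the
spacing `ξ` (the Riemann sums `Σ_{y′}ξ³P₂^δ(y − y′) ≤ 833/δ³` of p39's `tsum_profile_le`). [cite: Balaban1983Higgs3, (3.23) p.439] -/
theorem abs_second323L_le (hξ : 0 < ξ) (hξ1 : ξ ≤ 1) (hδ : 0 < δ) (hδ1 : δ ≤ 1) (hK' : 0 ≤ K')
    (hD : ∀ y y', |dK1 ξ μ G0 y y'| ≤ A * prof ξ δ 2 (y - y'))
    (hG : ∀ y y', |G y y'| ≤ B * prof ξ δ 1 (y - y')) (hg : ∀ x, |g x| ≤ 1)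
    (hlip : ∀ y y', |g' y' - g' y| ≤ K' * (ξ * (supNorm (y - y') : ℝ))) (y : ZSite 3) :
    Summable (secondTerm323 ξ μ G0 G g g' y) ∧
      |second323L ξ μ G0 G g g' y| ≤ A * B * K' * (833 / δ ^ 3) := by
  obtain ⟨⟨hs, hle⟩, -⟩ := tsum_profile_shift_le hξ hξ1 hδ hδ1 (le_refl 2) y y
  have hpt : ∀ y', |secondTerm323 ξ μ G0 G g g' y y'| ≤ A * B * K' * (ξ ^ 3 * prof ξ δ 2 (y - y')) :=
    fun y' => abs_secondTerm323_le hξ hδ.le hK' hD hG hg hlip y y'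
  have hs' : Summable fun y' => A * B * K' * (ξ ^ 3 * prof ξ δ 2 (y - y')) := hs.mul_left _
  have hsum : Summable (secondTerm323 ξ μ G0 G g g' y) :=
    Summable.of_norm_bounded hs' (fun y' => (Real.norm_eq_abs _).le.trans (hpt y'))
  refine ⟨hsum, ?_⟩
  have hP : 0 < prof ξ δ 2 (y - y) := prof_pos hξ δ 2 _
  have hABK : 0 ≤ A * B * K' := by
    have h0 := (abs_nonneg _).trans (hpt y)
    exact le_of_mul_le_mul_right (by rwa [zero_mul]) (mul_pos (pow_pos hξ 3) hP)
  calc |second323L ξ μ G0 G g g' y| = |∑' y', secondTerm323 ξ μ G0 G g g' y y'| := rfl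
    _ ≤ ∑' y', A * B * K' * (ξ ^ 3 * prof ξ δ 2 (y - y')) := abs_tsum_le_tsum_of_abs_le hsum hs' hpt
    _ = A * B * K' * ∑' y', ξ ^ 3 * prof ξ δ 2 (y - y') := tsum_mul_left
    _ ≤ A * B * K' * (833 / δ ^ 3) := mul_le_mul_of_nonneg_left hle hABK

end Second

/-! ## §4 *"Using the same method as in (3.16)"*: the replacement `G^ξ_{j″}(0) = C^ξ + M` inside the first term -/

section FirstAlgebra

variable {ξ : ℝ} {μ : Fin 3}

/-- **THE (3.16)-REPLACEMENT INSIDE THE FIRST TERM, SUMMAND BY SUMMAND** (model-free): if `G0(a,b) = C(a − b) + M0(a,b)` and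
`G(a,b) = C(a − b) + M(a,b)` (the resolvent identity preceding (3.16): `M = G^ξ_{j″}(0)(1 − m²_{j″} − a_{j″}P_{j″})C^ξ`), then
`ξ³(∂^ξ_μG0)(y,y′)G(y,y′) = ξ³(∂^ξ_μC)(y−y′)C(y−y′) + ξ³(∂^ξ_μC)(y−y′)M(y,y′) + ξ³(∂^ξ_μM0)(y,y′)G(y,y′)` — the printed `C^ξC^ξ`
term *"plus"* the cross terms (p39's torus `first323_G0xi_split`). [cite: Balaban1983Higgs3, (3.23) p.439] -/
theorem firstTerm323_split {G0 G : ZSite 3 → ZSite 3 → ℝ} {C : ZSite 3 → ℝ} {M0 M : ZSite 3 → ZSite 3 → ℝ}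
    (hG0 : ∀ a b, G0 a b = C (a - b) + M0 a b) (hG : ∀ a b, G a b = C (a - b) + M a b) (y y' : ZSite 3) :
    firstTerm323 ξ μ G0 G y y' =
      ξ ^ 3 * (pdiffZ ξ⁻¹ μ C (y - y') * C (y - y')) + ξ ^ 3 * (pdiffZ ξ⁻¹ μ C (y - y') * M y y') +
        ξ ^ 3 * (dK1 ξ μ M0 y y' * G y y') := by
  have e1 : dK1 ξ μ G0 y y' = pdiffZ ξ⁻¹ μ C (y - y') + dK1 ξ μ M0 y y' := by
    simp only [dK1, pdiffZ, hG0]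
    rw [show y + unitVec μ - y' = y - y' + unitVec μ by abel]
    ring
  have e2 : ξ ^ 3 * (pdiffZ ξ⁻¹ μ C (y - y') * G y y') =
      ξ ^ 3 * (pdiffZ ξ⁻¹ μ C (y - y') * C (y - y')) + ξ ^ 3 * (pdiffZ ξ⁻¹ μ C (y - y') * M y y') := by
    rw [hG]; ring
  calc firstTerm323 ξ μ G0 G y y'
      = ξ ^ 3 * (pdiffZ ξ⁻¹ μ C (y - y') * G y y') + ξ ^ 3 * (dK1 ξ μ M0 y y' * G y y') := by
        unfold firstTerm323; rw [e1]; ring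
    _ = _ := by rw [e2]

end FirstAlgebra

/-! ## §5 (3.24) on `ℤ³`: the symmetrisation identity and the uniform bound -/

section CC

variable {ξ : ℝ}

/-- kernel: `Σ_{1 ≤ n < b} n^{−2} ≤ 2` (`Σ_{n ≤ m} n^{−2} ≤ 2 − 1/m`). [folklore] -/
private theorem sum_Ico_inv_sq_le_two (b : ℕ) : ∑ n ∈ Finset.Ico 1 b, ((n : ℝ) ^ 2)⁻¹ ≤ 2 := by
  have key : ∀ m : ℕ, 1 ≤ m → ∑ n ∈ Finset.Ico 1 (m + 1), ((n : ℝ) ^ 2)⁻¹ ≤ 2 - 1 / (m : ℝ) := by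
    intro m hm
    induction m, hm using Nat.le_induction with
    | base =>
        rw [Nat.Ico_succ_singleton, Finset.sum_singleton]
        norm_num
    | succ m hm ih =>
        rw [Finset.sum_Ico_succ_top (by omega : 1 ≤ m + 1)]
        have hm1 : (1 : ℝ) ≤ m := by exact_mod_cast hm
        have h1 : (((m + 1 : ℕ) : ℝ) ^ 2)⁻¹ ≤ 1 / (m : ℝ) - 1 / ((m : ℝ) + 1) := by
          push_cast
          rw [div_sub_div _ _ (by positivity) (by positivity), inv_eq_one_div,
            div_le_div_iff₀ (by positivity) (by positivity)]
          nlinarith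
        have e : (((m + 1 : ℕ) : ℝ)) = (m : ℝ) + 1 := by push_cast; ring
        rw [e] at h1 ⊢
        linarith
  rcases Nat.lt_or_ge b 2 with hb | hb
  · interval_cases b <;> simp
  · obtain ⟨m, rfl⟩ : ∃ m, b = m + 1 := ⟨b - 1, by omega⟩
    have h := key m (by omega)
    have : (0 : ℝ) ≤ 1 / (m : ℝ) := by positivity
    linarith

/-- kernel: **`Σ_{u∈ℤ³} max(1,|u|_∞)^{−4} ≤ 53`** (summable; shells `#{|u|_∞ = n} ≤ 26n²`, `Σ_{n≥1}n^{−2} ≤ 2`) — the lattice sum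
behind the uniform bound of (3.24). [folklore] -/
private theorem summable_inv_max_pow_four_le :
    Summable (fun u : ZSite 3 => ((max 1 (supNorm u : ℝ)) ^ 4)⁻¹) ∧
      ∑' u : ZSite 3, ((max 1 (supNorm u : ℝ)) ^ 4)⁻¹ ≤ 53 := by
  set h : ℕ → ℝ := fun n => ((max 1 (n : ℝ)) ^ 4)⁻¹ with hh
  have hh0 : ∀ n, 0 ≤ h n := fun n => by positivity
  have hfin : ∀ F : Finset (ZSite 3), ∑ u ∈ F, h (supNorm u) ≤ 53 := by
    intro F
    refine (sum_radial_le h hh0 F).trans ?_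
    have hz : h 0 = 1 := by simp [hh]
    have hshell : ∀ n : ℕ, 1 ≤ n → 26 * (n : ℝ) ^ 2 * h n = 26 * ((n : ℝ) ^ 2)⁻¹ := by
      intro n hn
      have hn1 : (1 : ℝ) ≤ n := by exact_mod_cast hn
      simp only [hh, max_eq_right hn1]
      have hn0 : (n : ℝ) ≠ 0 := by positivity
      field_simp
    rw [Finset.sum_congr rfl fun n hn => hshell n (Finset.mem_Ico.1 hn).1, ← Finset.mul_sum, hz]
    have := sum_Ico_inv_sq_le_two (F.sup supNorm + 1)
    linarith
  have hsum : Summable (fun u : ZSite 3 => h (supNorm u)) := summable_of_sum_le (fun u => hh0 _) hfin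
  exact ⟨hsum, Real.tsum_le_of_sum_le (fun u => hh0 _) hfin⟩

/-- kernel: the substitution `u = x − x′` — `cc324 ξ μ C x = Σ'_uξ³(∂^ξ_μC)(u)C(u)`, independent of `x`.
[cite: Balaban1983Higgs3, (3.24) p.439] -/
theorem cc324_eq_tsum (ξ : ℝ) (μ : Fin 3) (C : ZSite 3 → ℝ) (x : ZSite 3) :
    cc324 ξ μ C x = ∑' u, ξ ^ 3 * (pdiffZ ξ⁻¹ μ C u * C u) := by
  unfold cc324
  have e := (Equiv.subLeft x).tsum_eq (fun u => ξ ^ 3 * (pdiffZ ξ⁻¹ μ C u * C u))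
  simp only [Equiv.subLeft_apply] at e
  exact e

/-- **(3.24) IN POSITION SPACE ON `ℤ³`** — PROVED for every square-summable convolution kernel `C` and every `ξ ≠ 0`: both
series converge and `Σ'_uξ³(∂^ξ_μC)(u)C(u) = −(ξ⁴/2)·Σ'_u((∂^ξ_μC)(u))²` — the `x`-space content of the printed symmetrisation
`∂^ξ_μ(p) ↦ ξ^{−1}(cos ξp_μ − 1) = −(ξ/2)|ξ^{−1}(e^{iξp_μ} − 1)|²` in the momentum integral of (3.24) (`ΣC(u+e_μ)² = ΣC(u)²` by the
lattice translation; p39's torus `B3Eq324Torus.sum_d1Kernel_mul_self`); in particular the (3.24) sum is `≤ 0`.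
[cite: Balaban1983Higgs3, (3.24) p.439] -/
theorem tsum_pdiffZ_mul_self (hξ : ξ ≠ 0) (μ : Fin 3) {C : ZSite 3 → ℝ} (hC : Summable fun u => C u ^ 2) :
    Summable (fun u => ξ ^ 3 * (pdiffZ ξ⁻¹ μ C u * C u)) ∧ Summable (fun u => pdiffZ ξ⁻¹ μ C u ^ 2) ∧
      ∑' u, ξ ^ 3 * (pdiffZ ξ⁻¹ μ C u * C u) = -(ξ ^ 4 / 2) * ∑' u, pdiffZ ξ⁻¹ μ C u ^ 2 := by
  set e : ZSite 3 := unitVec μ with he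
  have hA : Summable fun u => C (u + e) ^ 2 := by
    have h := (Equiv.addRight e).summable_iff.2 hC
    exact h.congr fun u => by simp only [Function.comp_apply, Equiv.coe_addRight]
  have hA' : ∑' u, C (u + e) ^ 2 = ∑' u, C u ^ 2 := by
    have h := (Equiv.addRight e).tsum_eq (fun u => C u ^ 2)
    simp only [Equiv.coe_addRight] at h
    exact h
  have hAB : Summable fun u => C (u + e) * C u := by
    refine Summable.of_norm_bounded ((hA.add hC).div_const 2) fun u => ?_
    rw [Real.norm_eq_abs, abs_mul]
    have h := two_mul_le_add_sq |C (u + e)| |C u|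
    rw [sq_abs, sq_abs] at h
    rw [le_div_iff₀ (by norm_num : (0 : ℝ) < 2)]
    linarith
  have hL : (fun u => ξ ^ 3 * (pdiffZ ξ⁻¹ μ C u * C u)) =
      fun u => ξ ^ 3 * ξ⁻¹ * (C (u + e) * C u) - ξ ^ 3 * ξ⁻¹ * C u ^ 2 := by
    funext u
    simp only [pdiffZ, ← he]
    ring
  have hR : (fun u => pdiffZ ξ⁻¹ μ C u ^ 2) =
      fun u => ξ⁻¹ ^ 2 * C (u + e) ^ 2 - 2 * ξ⁻¹ ^ 2 * (C (u + e) * C u) + ξ⁻¹ ^ 2 * C u ^ 2 := by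
    funext u
    simp only [pdiffZ, ← he]
    ring
  have s1a := hAB.mul_left (ξ ^ 3 * ξ⁻¹)
  have s1b := hC.mul_left (ξ ^ 3 * ξ⁻¹)
  have s2a := hA.mul_left (ξ⁻¹ ^ 2)
  have s2b := hAB.mul_left (2 * ξ⁻¹ ^ 2)
  have s2c := hC.mul_left (ξ⁻¹ ^ 2)
  refine ⟨by rw [hL]; exact s1a.sub s1b, by rw [hR]; exact (s2a.sub s2b).add s2c, ?_⟩
  rw [hL, hR, s1a.tsum_sub s1b, (s2a.sub s2b).tsum_add s2c, s2a.tsum_sub s2b, tsum_mul_left, tsum_mul_left,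
    tsum_mul_left, tsum_mul_left, tsum_mul_left, hA']
  field_simp
  ring

/-- **THE (3.24) SUM IS BOUNDED UNIFORMLY IN THE SPACING** (model-free, `d = 3`): if `|(∂^ξ_μC)(u)| ≤ A·P₂^δ(u)` (the printed
law for the differentiated free propagator) and `Σ'C² < ∞`, then for every `x` the series `cc324 ξ μ C x` converges, is `≤ 0`,
and `|cc324 ξ μ C x| ≤ (53/2)·A²` FOR EVERY `ξ > 0` — by §5's identity, `((∂C)(u))² ≤ A²ξ^{−4}max(1,|u|_∞)^{−4}` and
`Σ_{u∈ℤ³}max(1,|u|_∞)^{−4} ≤ 53`; the boundedness that p. 439 draws from *"the expression on the right side has a finite limit as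
ξ → 0"*. [cite: Balaban1983Higgs3, (3.24) p.439] -/
theorem abs_cc324_le {δ A : ℝ} (hξ : 0 < ξ) (hδ : 0 ≤ δ) (μ : Fin 3) {C : ZSite 3 → ℝ}
    (hdC : ∀ u, |pdiffZ ξ⁻¹ μ C u| ≤ A * prof ξ δ 2 u) (hC2 : Summable fun u => C u ^ 2) (x : ZSite 3) :
    Summable (fun x' => ξ ^ 3 * (pdiffZ ξ⁻¹ μ C (x - x') * C (x - x'))) ∧
      cc324 ξ μ C x ≤ 0 ∧ |cc324 ξ μ C x| ≤ A ^ 2 * (53 / 2) := by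
  have hξ0 : ξ ≠ 0 := hξ.ne'
  obtain ⟨s1, s2, heq⟩ := tsum_pdiffZ_mul_self hξ0 μ hC2
  obtain ⟨hs4, hle4⟩ := summable_inv_max_pow_four_le
  have hP0 : 0 < prof ξ δ 2 0 := prof_pos hξ δ 2 0
  have hA : 0 ≤ A :=
    le_of_mul_le_mul_right (by rw [zero_mul]; exact (abs_nonneg _).trans (hdC 0)) hP0
  -- pointwise: `((∂C)(u))² ≤ A²ξ⁻⁴max(1,|u|)⁻⁴`
  have hpt : ∀ u, pdiffZ ξ⁻¹ μ C u ^ 2 ≤ A ^ 2 * ((ξ ^ 4)⁻¹ * ((max 1 (supNorm u : ℝ)) ^ 4)⁻¹) := by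
    intro u
    have hP2 : prof ξ δ 2 u ≤ ((ξ * max 1 (supNorm u : ℝ)) ^ 2)⁻¹ := by
      unfold prof
      have h2 : Real.exp (-(δ * (ξ * (supNorm u : ℝ)))) ≤ 1 := Real.exp_le_one_iff.2 (by
        have : 0 ≤ δ * (ξ * (supNorm u : ℝ)) := by positivity
        linarith)
      exact (mul_le_mul_of_nonneg_left h2 (by positivity)).trans_eq (mul_one _)
    have h1 : |pdiffZ ξ⁻¹ μ C u| ≤ A * ((ξ * max 1 (supNorm u : ℝ)) ^ 2)⁻¹ :=
      (hdC u).trans (mul_le_mul_of_nonneg_left hP2 hA)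
    have hm0 : (max 1 (supNorm u : ℝ)) ≠ 0 := by positivity
    calc pdiffZ ξ⁻¹ μ C u ^ 2 = |pdiffZ ξ⁻¹ μ C u| ^ 2 := (sq_abs _).symm
      _ ≤ (A * ((ξ * max 1 (supNorm u : ℝ)) ^ 2)⁻¹) ^ 2 := pow_le_pow_left₀ (abs_nonneg _) h1 2
      _ = A ^ 2 * ((ξ ^ 4)⁻¹ * ((max 1 (supNorm u : ℝ)) ^ 4)⁻¹) := by
          field_simp
  have hs' : Summable fun u : ZSite 3 => A ^ 2 * ((ξ ^ 4)⁻¹ * ((max 1 (supNorm u : ℝ)) ^ 4)⁻¹) :=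
    (hs4.mul_left _).mul_left _
  have hS : ∑' u, pdiffZ ξ⁻¹ μ C u ^ 2 ≤ A ^ 2 * ((ξ ^ 4)⁻¹ * 53) := by
    refine (s2.tsum_le_tsum hpt hs').trans ?_
    rw [tsum_mul_left, tsum_mul_left]
    exact mul_le_mul_of_nonneg_left (mul_le_mul_of_nonneg_left hle4 (by positivity)) (by positivity)
  have hsq0 : 0 ≤ ∑' u, pdiffZ ξ⁻¹ μ C u ^ 2 := tsum_nonneg fun u => sq_nonneg _
  have hsx : Summable (fun x' => ξ ^ 3 * (pdiffZ ξ⁻¹ μ C (x - x') * C (x - x'))) := by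
    have h := (Equiv.subLeft x).summable_iff.2 s1
    exact h.congr fun x' => by simp only [Function.comp_apply, Equiv.subLeft_apply]
  refine ⟨hsx, ?_, ?_⟩
  · rw [cc324_eq_tsum, heq]
    have : 0 ≤ ξ ^ 4 / 2 := by positivity
    nlinarith
  · rw [cc324_eq_tsum, heq, abs_mul, abs_neg, abs_of_pos (by positivity : (0 : ℝ) < ξ ^ 4 / 2), abs_of_nonneg hsq0]
    calc ξ ^ 4 / 2 * ∑' u, pdiffZ ξ⁻¹ μ C u ^ 2 ≤ ξ ^ 4 / 2 * (A ^ 2 * ((ξ ^ 4)⁻¹ * 53)) :=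
          mul_le_mul_of_nonneg_left hS (by positivity)
      _ = A ^ 2 * (53 / 2) := by
          field_simp

/-- kernel: a kernel obeying the propagator law `|C(u)| ≤ A·P₁^δ(u)` (`0 < ξ ≤ 1`, `0 < δ ≤ 1`) is square-summable on `ℤ³`
(`C² ≤ A²P₁·ξ^{−1}` and `Σξ³P₁ < ∞`). [cite: Balaban1983Higgs3, (3.24) p.439] -/
theorem summable_sq_of_prof_one {δ A : ℝ} (hξ : 0 < ξ) (hξ1 : ξ ≤ 1) (hδ : 0 < δ) (hδ1 : δ ≤ 1)
    {C : ZSite 3 → ℝ} (hC : ∀ u, |C u| ≤ A * prof ξ δ 1 u) : Summable fun u => C u ^ 2 := by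
  obtain ⟨hs, -⟩ := tsum_profile_le (d := 3) rfl hξ hξ1 hδ hδ1 (q := 1) (by norm_num)
  have hξ0 : ξ ≠ 0 := hξ.ne'
  have hs' : Summable fun u : ZSite 3 => A ^ 2 * ξ⁻¹ * (ξ ^ 3)⁻¹ * (ξ ^ 3 * prof ξ δ 1 u) := hs.mul_left _
  refine Summable.of_nonneg_of_le (fun u => sq_nonneg _) (fun u => ?_) hs'
  have hP : 0 ≤ prof ξ δ 1 u := prof_nonneg hξ.le δ 1 u
  have hPle : prof ξ δ 1 u ≤ (ξ ^ 1)⁻¹ := profile_le_inv_pow hξ hδ.le 1 u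
  calc C u ^ 2 = |C u| ^ 2 := (sq_abs _).symm
    _ ≤ (A * prof ξ δ 1 u) ^ 2 := pow_le_pow_left₀ (abs_nonneg _) (hC u) 2
    _ = A ^ 2 * prof ξ δ 1 u * prof ξ δ 1 u := by ring
    _ ≤ A ^ 2 * prof ξ δ 1 u * (ξ ^ 1)⁻¹ := mul_le_mul_of_nonneg_left hPle (mul_nonneg (sq_nonneg A) hP)
    _ = A ^ 2 * ξ⁻¹ * (ξ ^ 3)⁻¹ * (ξ ^ 3 * prof ξ δ 1 u) := by
        field_simp

/-- **(3.24), THE DICTIONARY WITH THE PRINTED MOMENTUM INTEGRAL**: for the free propagator `C^ξ` (`Cxi 3 ξ`) and `ξ > 0`,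
`cc324 ξ μ C^ξ x = (2π)^{−3}∫_{|p|≤π/ξ}ξ^{−1}(cos ξp_μ − 1)/(Δ^ξ(p) + 1)²dp` — the first equality of (3.24), p03's
`B3Eq324Parseval.eq324_holds` BY NAME (the object bounded in `abs_cc324_le` IS the printed one). [cite: Balaban1983Higgs3, (3.24) p.439] -/
theorem cc324_Cxi_eq_integral (hξ : 0 < ξ) (μ : Fin 3) (x : ZSite 3) :
    cc324 ξ μ (Cxi 3 ξ) x =
      (2 * Real.pi)⁻¹ ^ 3 * ∫ p in bzBox 3 ξ, ξ⁻¹ * (Real.cos (ξ * p μ) - 1) / (lapSymbol 3 ξ p + 1) ^ 2 :=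
  ((B3Eq324Parseval.eq324_holds (d := 3) hξ) μ x).1

end CC

/-! ## §6 The print's propagator: *"some convergent expressions plus"* (3.24), hypothesis-free -/

section Instance

variable {ℓ k : ℕ} {a m2 : ℝ}

/-- **"WE GET SOME CONVERGENT EXPRESSIONS PLUS q²g(x)g′(x)Σ_{x′}ξ^d(∂^ξ_μC^ξ)(x − x′)C^ξ(x − x′)" — PROVED ON THE PRINT'S CARRIER
`ξℤ³`** for the infinite-lattice zero-field propagator `G^ξ_{j″}(0) = G_{j″}(ξℤ³,0)` (p39's `GxiL ℓ k`, `k = j″`, `ξ = L^{−k}`),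
its free part `C^ξ` and `M = G^ξ_{j″}(0) − C^ξ`: there are `0 < δ ≤ 1`, `C ≥ 1` and `Cst > 0`, functions of `L` and the window
`[a₋,a₊] × [0,m²₊]` only, such that for EVERY `k ≥ 1` and window point the laws `|G^ξ_k(0;y,y′)| ≤ C·P₁^δ(y−y′)`,
`|(∂^ξ_μG^ξ_k(0))(y,y′)| ≤ C·P₂^δ(y−y′)` hold and, for every `μ` and `y`, each of the three series of the (3.16)-replacement
converges absolutely with absolute value `≤ Cst`: the (3.24) term `cc324 ξ μ C^ξ y` (also `≤ 0`; §5 with `Σ'(C^ξ)² < ∞`), the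
cross term `Σ'_{y′}ξ³(∂^ξ_μC^ξ)(y−y′)M(y,y′)` (`|M| ≤ K`, `Σ_{y′}ξ³P₂^δ ≤ 833/δ³`) and the cross term `Σ'_{y′}ξ³(∂^ξ_μM)(y,y′)G^ξ_k(0)(y,y′)`
(p39's transposed Fubini bound) — uniformly in `k`, the window and `y`.  The laws are p39's
`B3Eq316DifferenceKernelBounds.exists_bounds`. [cite: Balaban1983Higgs3, (3.23) p.439] -/
theorem exists_pieces323_bound (hℓ : 1 ≤ ℓ) (amin aplus m2plus : ℝ) (ha : 0 < amin) :
    ∃ δ C Cst : ℝ, 0 < δ ∧ δ ≤ 1 ∧ 1 ≤ C ∧ 0 < Cst ∧ ∀ (k : ℕ), 1 ≤ k → ∀ (a m2 : ℝ), amin ≤ a → a ≤ aplus →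
      0 ≤ m2 → m2 ≤ m2plus →
      (∀ y y' : ZSite 3, |GxiL ℓ k a m2 y y'| ≤ C * prof (xiOf ℓ k) δ 1 (y - y')) ∧
      (∀ (μ : Fin 3) (y y' : ZSite 3), |dK1 (xiOf ℓ k) μ (GxiL ℓ k a m2) y y'| ≤ C * prof (xiOf ℓ k) δ 2 (y - y')) ∧
      ∀ (μ : Fin 3) (y : ZSite 3),
        (Summable (fun y' => xiOf ℓ k ^ 3 *
            (pdiffZ (xiOf ℓ k)⁻¹ μ (Cxi 3 (xiOf ℓ k)) (y - y') * Cxi 3 (xiOf ℓ k) (y - y'))) ∧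
          cc324 (xiOf ℓ k) μ (Cxi 3 (xiOf ℓ k)) y ≤ 0 ∧ |cc324 (xiOf ℓ k) μ (Cxi 3 (xiOf ℓ k)) y| ≤ Cst) ∧
        (Summable (fun y' => xiOf ℓ k ^ 3 *
            (pdiffZ (xiOf ℓ k)⁻¹ μ (Cxi 3 (xiOf ℓ k)) (y - y') * MxiL ℓ k a m2 y y')) ∧
          |∑' y', xiOf ℓ k ^ 3 * (pdiffZ (xiOf ℓ k)⁻¹ μ (Cxi 3 (xiOf ℓ k)) (y - y') * MxiL ℓ k a m2 y y')| ≤ Cst) ∧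
        (Summable (fun y' => xiOf ℓ k ^ 3 * (dK1 (xiOf ℓ k) μ (MxiL ℓ k a m2) y y' * GxiL ℓ k a m2 y y')) ∧
          |∑' y', xiOf ℓ k ^ 3 * (dK1 (xiOf ℓ k) μ (MxiL ℓ k a m2) y y' * GxiL ℓ k a m2 y y')| ≤ Cst) := by
  obtain ⟨δ, C, K, hδ, hδh, hC1, hK, hB⟩ := exists_bounds hℓ amin aplus m2plus ha
  have hδ1 : δ ≤ 1 := hδh.trans (by norm_num)
  have hC0 : 0 ≤ C := le_trans (by norm_num) hC1
  have hCpos : 0 < C := lt_of_lt_of_le (by norm_num) hC1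
  set Cst : ℝ := C ^ 2 * (53 / 2) + C * K * (833 / δ ^ 3) + C * C * C * ((833 / δ ^ 3) * (833 / δ ^ 3)) with hCst
  have t1 : 0 ≤ C ^ 2 * (53 / 2) := by positivity
  have t2 : 0 ≤ C * K * (833 / δ ^ 3) := by positivity
  have t3 : 0 ≤ C * C * C * ((833 / δ ^ 3) * (833 / δ ^ 3)) := by positivity
  have h1 : C ^ 2 * (53 / 2) ≤ Cst := by rw [hCst]; linarith
  have h2 : C * K * (833 / δ ^ 3) ≤ Cst := by rw [hCst]; linarith
  have h3 : C * C * C * ((833 / δ ^ 3) * (833 / δ ^ 3)) ≤ Cst := by rw [hCst]; linarith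
  have hCst0 : 0 < Cst := by
    have : 0 < C ^ 2 * (53 / 2) := by positivity
    linarith
  refine ⟨δ, C, Cst, hδ, hδ1, hC1, hCst0, ?_⟩
  intro k hk a m2 ha1 ha2 hm1 hm2
  obtain ⟨⟨l1, l2, -, -, -, -, l7, -, l9⟩, hM, -, -, -, -, hT⟩ := hB k hk a m2 ha1 ha2 hm1 hm2
  have hξ := xiOf_pos ℓ k
  have hξ1 := xiOf_le_one ℓ k
  refine ⟨l1, l2, fun μ y => ⟨?_, ?_, ?_⟩⟩
  · -- the (3.24) term
    have hC2 : Summable fun u => Cxi 3 (xiOf ℓ k) u ^ 2 := summable_sq_of_prof_one hξ hξ1 hδ hδ1 l7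
    obtain ⟨hs, hnp, hle⟩ := abs_cc324_le hξ hδ.le μ (l9 μ) hC2 y
    exact ⟨hs, hnp, hle.trans h1⟩
  · -- the cross term `(∂C^ξ)·M`
    obtain ⟨⟨hs, hle⟩, -⟩ := tsum_profile_shift_le hξ hξ1 hδ hδ1 (le_refl 2) y y
    have hpt : ∀ y', |xiOf ℓ k ^ 3 * (pdiffZ (xiOf ℓ k)⁻¹ μ (Cxi 3 (xiOf ℓ k)) (y - y') * MxiL ℓ k a m2 y y')| ≤
        C * K * (xiOf ℓ k ^ 3 * prof (xiOf ℓ k) δ 2 (y - y')) := by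
      intro y'
      rw [abs_mul, abs_of_pos (pow_pos hξ 3), abs_mul]
      have hP : 0 ≤ prof (xiOf ℓ k) δ 2 (y - y') := prof_nonneg hξ.le _ _ _
      calc xiOf ℓ k ^ 3 * (|pdiffZ (xiOf ℓ k)⁻¹ μ (Cxi 3 (xiOf ℓ k)) (y - y')| * |MxiL ℓ k a m2 y y'|)
          ≤ xiOf ℓ k ^ 3 * (C * prof (xiOf ℓ k) δ 2 (y - y') * K) :=
            mul_le_mul_of_nonneg_left (mul_le_mul (l9 μ (y - y')) (hM y y') (abs_nonneg _) (mul_nonneg hC0 hP))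
              (pow_pos hξ 3).le
        _ = C * K * (xiOf ℓ k ^ 3 * prof (xiOf ℓ k) δ 2 (y - y')) := by ring
    have hs' : Summable fun y' => C * K * (xiOf ℓ k ^ 3 * prof (xiOf ℓ k) δ 2 (y - y')) := hs.mul_left _
    have hsum := Summable.of_norm_bounded hs' (fun y' => (Real.norm_eq_abs _).le.trans (hpt y'))
    refine ⟨hsum, ?_⟩
    calc |∑' y', xiOf ℓ k ^ 3 * (pdiffZ (xiOf ℓ k)⁻¹ μ (Cxi 3 (xiOf ℓ k)) (y - y') * MxiL ℓ k a m2 y y')|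
        ≤ ∑' y', C * K * (xiOf ℓ k ^ 3 * prof (xiOf ℓ k) δ 2 (y - y')) := abs_tsum_le_tsum_of_abs_le hsum hs' hpt
      _ = C * K * ∑' y', xiOf ℓ k ^ 3 * prof (xiOf ℓ k) δ 2 (y - y') := tsum_mul_left
      _ ≤ C * K * (833 / δ ^ 3) := mul_le_mul_of_nonneg_left hle (mul_nonneg hC0 hK.le)
      _ ≤ Cst := h2
  · -- the cross term `(∂M)·G^ξ_k(0)`, transposed Fubini
    have hκ : ∀ y', |GxiL ℓ k a m2 y y'| ≤ C * prof (xiOf ℓ k) δ 1 (y' - y) := fun y' => by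
      rw [prof_sub_comm]; exact l1 y y'
    obtain ⟨hs, hle⟩ := hT μ y (fun y' => GxiL ℓ k a m2 y y') C hC0 hκ
    exact ⟨hs, hle.trans h3⟩

/-- kernel: `G^ξ_k(0)(a,b) = C^ξ(a − b) + M(a,b)` — the definition of p39's `MxiL`. [cite: Balaban1983Higgs3, (3.16) p.437] -/
theorem GxiL_eq_Cxi_add_MxiL (ℓ k : ℕ) (a m2 : ℝ) (p q : ZSite 3) :
    GxiL ℓ k a m2 p q = Cxi 3 (xiOf ℓ k) (p - q) + MxiL ℓ k a m2 p q := by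
  simp only [MxiL]
  ring

/-- **THE (3.16)-REPLACEMENT INSIDE THE FIRST TERM FOR THE PRINT'S PROPAGATOR, HYPOTHESIS-FREE**: for every `k = j″ ≥ 1`,
`0 < a`, `0 ≤ m²`, `μ`, `y`, the first-term series for `(G^ξ_k(0), G^ξ_k(0))` converges and
`first323L(y) = cc324 ξ μ C^ξ y + Σ'_{y′}ξ³(∂^ξ_μC^ξ)(y−y′)M(y,y′) + Σ'_{y′}ξ³(∂^ξ_μM)(y,y′)G^ξ_k(0)(y,y′)` — the printed
`C^ξC^ξ` sum (3.24) *"plus"* the two *"convergent expressions"*. [cite: Balaban1983Higgs3, (3.23) p.439] -/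
theorem first323L_GxiL_split (hℓ : 1 ≤ ℓ) (hk : 1 ≤ k) (ha : 0 < a) (hm : 0 ≤ m2) (μ : Fin 3) (y : ZSite 3) :
    Summable (firstTerm323 (xiOf ℓ k) μ (GxiL ℓ k a m2) (GxiL ℓ k a m2) y) ∧
      first323L (xiOf ℓ k) μ (GxiL ℓ k a m2) (GxiL ℓ k a m2) y =
        cc324 (xiOf ℓ k) μ (Cxi 3 (xiOf ℓ k)) y +
          (∑' y', xiOf ℓ k ^ 3 * (pdiffZ (xiOf ℓ k)⁻¹ μ (Cxi 3 (xiOf ℓ k)) (y - y') * MxiL ℓ k a m2 y y')) +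
          ∑' y', xiOf ℓ k ^ 3 * (dK1 (xiOf ℓ k) μ (MxiL ℓ k a m2) y y' * GxiL ℓ k a m2 y y') := by
  obtain ⟨δ, C, Cst, -, -, -, -, h⟩ := exists_pieces323_bound hℓ a a m2 ha
  obtain ⟨-, -, hh⟩ := h k hk a m2 le_rfl le_rfl hm le_rfl
  obtain ⟨⟨sCC, -, -⟩, ⟨sCM, -⟩, ⟨sMG, -⟩⟩ := hh μ y
  have e : firstTerm323 (xiOf ℓ k) μ (GxiL ℓ k a m2) (GxiL ℓ k a m2) y = fun y' =>
      xiOf ℓ k ^ 3 * (pdiffZ (xiOf ℓ k)⁻¹ μ (Cxi 3 (xiOf ℓ k)) (y - y') * Cxi 3 (xiOf ℓ k) (y - y')) +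
        xiOf ℓ k ^ 3 * (pdiffZ (xiOf ℓ k)⁻¹ μ (Cxi 3 (xiOf ℓ k)) (y - y') * MxiL ℓ k a m2 y y') +
        xiOf ℓ k ^ 3 * (dK1 (xiOf ℓ k) μ (MxiL ℓ k a m2) y y' * GxiL ℓ k a m2 y y') :=
    funext fun y' => firstTerm323_split (GxiL_eq_Cxi_add_MxiL ℓ k a m2) (GxiL_eq_Cxi_add_MxiL ℓ k a m2) y y'
  refine ⟨by rw [e]; exact (sCC.add sCM).add sMG, ?_⟩
  unfold first323L cc324
  rw [e, (sCC.add sCM).tsum_add sMG, sCC.tsum_add sCM]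

/-- **THE FIRST TERM OF (3.23) IS BOUNDED BY A CONSTANT ON THE PRINT'S CARRIER**: there is `Cst > 0` (on `L` and the window
only) such that for every `k = j″ ≥ 1`, window point, `μ`, `y` the first-term series for `(G^ξ_k(0), G^ξ_k(0))` converges and
`|Σ'_{y′}ξ³(∂^ξ_μG^ξ_k(0))(y,y′)G^ξ_k(0)(y,y′)| ≤ Cst` — *"some convergent expressions plus"* the bounded (3.24) term.
[cite: Balaban1983Higgs3, (3.23) p.439] -/
theorem exists_first323L_GxiL_bound (hℓ : 1 ≤ ℓ) (amin aplus m2plus : ℝ) (ha : 0 < amin) :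
    ∃ Cst : ℝ, 0 < Cst ∧ ∀ (k : ℕ), 1 ≤ k → ∀ (a m2 : ℝ), amin ≤ a → a ≤ aplus → 0 ≤ m2 → m2 ≤ m2plus →
      ∀ (μ : Fin 3) (y : ZSite 3),
        Summable (firstTerm323 (xiOf ℓ k) μ (GxiL ℓ k a m2) (GxiL ℓ k a m2) y) ∧
          |first323L (xiOf ℓ k) μ (GxiL ℓ k a m2) (GxiL ℓ k a m2) y| ≤ Cst := by
  obtain ⟨δ, C, Cst, hδ, hδ1, hC1, hCst, h⟩ := exists_pieces323_bound hℓ amin aplus m2plus ha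
  refine ⟨3 * Cst, by positivity, ?_⟩
  intro k hk a m2 ha1 ha2 hm1 hm2 μ y
  have ha0 : 0 < a := ha.trans_le ha1
  obtain ⟨-, -, hh⟩ := h k hk a m2 ha1 ha2 hm1 hm2
  obtain ⟨⟨-, -, bCC⟩, ⟨-, bCM⟩, ⟨-, bMG⟩⟩ := hh μ y
  obtain ⟨hs, heq⟩ := first323L_GxiL_split hℓ hk ha0 hm1 μ y
  refine ⟨hs, ?_⟩
  rw [heq]
  have hA := abs_add_le (cc324 (xiOf ℓ k) μ (Cxi 3 (xiOf ℓ k)) y)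
    (∑' y', xiOf ℓ k ^ 3 * (pdiffZ (xiOf ℓ k)⁻¹ μ (Cxi 3 (xiOf ℓ k)) (y - y') * MxiL ℓ k a m2 y y'))
  have hB := abs_add_le (cc324 (xiOf ℓ k) μ (Cxi 3 (xiOf ℓ k)) y +
      ∑' y', xiOf ℓ k ^ 3 * (pdiffZ (xiOf ℓ k)⁻¹ μ (Cxi 3 (xiOf ℓ k)) (y - y') * MxiL ℓ k a m2 y y'))
    (∑' y', xiOf ℓ k ^ 3 * (dK1 (xiOf ℓ k) μ (MxiL ℓ k a m2) y y' * GxiL ℓ k a m2 y y'))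
  linarith

/-- **"HENCE THE LAST GRAPH IN (3.22) DEFINES A VERTEX WITH SOME CONVERGENT FUNCTION" — THE SQUARE BRACKET OF (3.23) IS BOUNDED
ON THE PRINT'S CARRIER `ξℤ³`**, both propagator slots the zero-field `G^ξ_{j″}(0) = G_{j″}(ξℤ³,0)` (at zero field the second
slot has the same kernel): there are `C₁, C₂ > 0` (functions of `L` and the window) such that for every `k = j″ ≥ 1`, window
point, Lipschitz constant `K′ ≥ 0`, localizations `|g|, |g′| ≤ 1` with `|g′(y′) − g′(y)| ≤ K′·ξ|y − y′|_∞`, every `μ` and `y`: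
the (3.23) series converges absolutely, the second-term series converges with `|second323L(y)| ≤ C₂K′`, the p. 439 splitting
`[(3.23)](y) = g(y)g′(y)·first323L(y) + second323L(y)` holds, and `|[(3.23)](y)| ≤ C₁ + C₂K′` — uniformly in `k`, the window
and `y`, with NO kernel hypothesis left. [cite: Balaban1983Higgs3, (3.23) p.439] -/
theorem exists_bracket323L_GxiL_bound (hℓ : 1 ≤ ℓ) (amin aplus m2plus : ℝ) (ha : 0 < amin) :
    ∃ C₁ C₂ : ℝ, 0 < C₁ ∧ 0 < C₂ ∧ ∀ (k : ℕ), 1 ≤ k → ∀ (a m2 : ℝ), amin ≤ a → a ≤ aplus → 0 ≤ m2 → m2 ≤ m2plus →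
      ∀ (K' : ℝ), 0 ≤ K' → ∀ (g g' : ZSite 3 → ℝ), (∀ x, |g x| ≤ 1) → (∀ x, |g' x| ≤ 1) →
        (∀ y y' : ZSite 3, |g' y' - g' y| ≤ K' * (xiOf ℓ k * (supNorm (y - y') : ℝ))) →
        ∀ (μ : Fin 3) (y : ZSite 3),
          Summable (term323 (xiOf ℓ k) μ (GxiL ℓ k a m2) (GxiL ℓ k a m2) g g' y) ∧
          (Summable (secondTerm323 (xiOf ℓ k) μ (GxiL ℓ k a m2) (GxiL ℓ k a m2) g g' y) ∧
            |second323L (xiOf ℓ k) μ (GxiL ℓ k a m2) (GxiL ℓ k a m2) g g' y| ≤ C₂ * K') ∧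
          bracket323L (xiOf ℓ k) μ (GxiL ℓ k a m2) (GxiL ℓ k a m2) g g' y =
            g y * g' y * first323L (xiOf ℓ k) μ (GxiL ℓ k a m2) (GxiL ℓ k a m2) y +
              second323L (xiOf ℓ k) μ (GxiL ℓ k a m2) (GxiL ℓ k a m2) g g' y ∧
          |bracket323L (xiOf ℓ k) μ (GxiL ℓ k a m2) (GxiL ℓ k a m2) g g' y| ≤ C₁ + C₂ * K' := by
  obtain ⟨δ, C, Cst, hδ, hδ1, hC1, -, h⟩ := exists_pieces323_bound hℓ amin aplus m2plus ha
  obtain ⟨C₁, hC₁, hF⟩ := exists_first323L_GxiL_bound hℓ amin aplus m2plus ha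
  have hCpos : 0 < C := lt_of_lt_of_le (by norm_num) hC1
  refine ⟨C₁, C * C * (833 / δ ^ 3), hC₁, by positivity, ?_⟩
  intro k hk a m2 ha1 ha2 hm1 hm2 K' hK' g g' hg hg' hlip μ y
  obtain ⟨l1, l2, -⟩ := h k hk a m2 ha1 ha2 hm1 hm2
  obtain ⟨hs1, hb1⟩ := hF k hk a m2 ha1 ha2 hm1 hm2 μ y
  have hξ := xiOf_pos ℓ k
  have hξ1 := xiOf_le_one ℓ k
  obtain ⟨hs2, hb2⟩ := abs_second323L_le hξ hξ1 hδ hδ1 hK' (l2 μ) l1 hg hlip y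
  obtain ⟨hs, heq⟩ := bracket323L_split hs1 hs2
  refine ⟨hs, ⟨hs2, hb2.trans_eq (by ring)⟩, heq, ?_⟩
  rw [heq]
  have hgg : |g y * g' y| ≤ 1 := by
    rw [abs_mul]
    exact mul_le_one₀ (hg y) (abs_nonneg _) (hg' y)
  calc |g y * g' y * first323L (xiOf ℓ k) μ (GxiL ℓ k a m2) (GxiL ℓ k a m2) y +
          second323L (xiOf ℓ k) μ (GxiL ℓ k a m2) (GxiL ℓ k a m2) g g' y|
      ≤ |g y * g' y * first323L (xiOf ℓ k) μ (GxiL ℓ k a m2) (GxiL ℓ k a m2) y| +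
          |second323L (xiOf ℓ k) μ (GxiL ℓ k a m2) (GxiL ℓ k a m2) g g' y| := abs_add_le _ _
    _ ≤ 1 * C₁ + C * C * K' * (833 / δ ^ 3) := by
        refine add_le_add ?_ hb2
        rw [abs_mul]
        exact mul_le_mul hgg hb1 (abs_nonneg _) zero_le_one
    _ = C₁ + C * C * (833 / δ ^ 3) * K' := by ring

end Instance

/-! ## §7 The p. 439 rescaling sentence: from the `η`-lattice to the `L^{−j″}`-lattice -/

section Rescale

/-- kernel: `∂^ξ_μ` of a rescaled kernel: `dK1 (rξ) μ (r⁻¹K) = r⁻²·dK1 ξ μ K` (`∂^η = r^{−1}∂^ξ`, `η = rξ`; p20's torus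
`d1Kernel_rescale`). [cite: Balaban1983Higgs3, (3.23) p.439] -/
theorem dK1_rescale (r ξ : ℝ) (μ : Fin 3) (K : ZSite 3 → ZSite 3 → ℝ) (x y : ZSite 3) :
    dK1 (r * ξ) μ (fun p q => r⁻¹ * K p q) x y = r⁻¹ ^ 2 * dK1 ξ μ K x y := by
  simp only [dK1, mul_inv]
  ring

/-- **p. 439, THE RESCALING SENTENCE, MODEL-FREE ON `ℤ³`** (`d = 3`): *"Rescaling from the η-lattice to the L^{−j″}-lattice"* —
with `η = rξ` and both propagators rescaled by `r^{−d+2} = r^{−1}`, the (3.23)-summand on the `η`-lattice EQUALS the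
(3.23)-summand on the `ξ`-lattice at the same integer labels (`η³·r⁻²·r⁻¹ = ξ³`, exact in `d = 3`; p20's torus
`bracket323_rescale_three`). [cite: Balaban1983Higgs3, (3.23) p.439] -/
theorem term323_rescale {r : ℝ} (hr : r ≠ 0) (ξ : ℝ) (μ : Fin 3) (K G : ZSite 3 → ZSite 3 → ℝ) (g g' : ZSite 3 → ℝ)
    (y y' : ZSite 3) :
    term323 (r * ξ) μ (fun p q => r⁻¹ * K p q) (fun p q => r⁻¹ * G p q) g g' y y' = term323 ξ μ K G g g' y y' := by
  simp only [term323, dK1_rescale, mul_pow, inv_pow]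
  field_simp

/-- kernel: hence the square brackets agree as series. [cite: Balaban1983Higgs3, (3.23) p.439] -/
theorem bracket323L_rescale {r : ℝ} (hr : r ≠ 0) (ξ : ℝ) (μ : Fin 3) (K G : ZSite 3 → ZSite 3 → ℝ)
    (g g' : ZSite 3 → ℝ) (y : ZSite 3) :
    bracket323L (r * ξ) μ (fun p q => r⁻¹ * K p q) (fun p q => r⁻¹ * G p q) g g' y = bracket323L ξ μ K G g g' y :=
  tsum_congr fun y' => term323_rescale hr ξ μ K G g g' y y'

/-- **p. 439, THE RESCALING SENTENCE FOR THE PRINT'S PROPAGATOR**: the square bracket of (3.23) built ON THE `η`-LATTICE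
(`η = L^{−k}`) from the `η`-lattice propagator `G^η_{j″}(0)` of the `j″`-th step (p39 g11's `GetaL ℓ j k`, `j = j″ ≤ k`; second
slot `(L^{j″}η)^{−1}G` = the `η`-lattice reading of a `ξ`-lattice kernel `G`) EQUALS the square bracket built on the
`ξ = L^{−j″}`-lattice from `G^ξ_{j″}(0)` (`GxiL ℓ j`) — an exact identity in `d = 3` for all localizations, `μ` and labels `y`.
[cite: Balaban1983Higgs3, (3.23) p.439] -/
theorem bracket323L_eta_eq (ℓ j k : ℕ) (a m2 : ℝ) (G : ZSite 3 → ZSite 3 → ℝ) (g g' : ZSite 3 → ℝ) (μ : Fin 3)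
    (y : ZSite 3) :
    bracket323L (xiOf ℓ k) μ (GetaL ℓ j k a m2) (fun p q => (scale330 ℓ j k)⁻¹ * G p q) g g' y =
      bracket323L (xiOf ℓ j) μ (GxiL ℓ j a m2) G g g' y := by
  rw [GetaL_eq ℓ j k a m2, xiOf_eq_scale_mul ℓ j k]
  exact bracket323L_rescale (scale330_pos ℓ j k).ne' _ _ _ _ _ _ _

/-- kernel: a localization `g′` that is `K′`-Lipschitz for the `η`-lattice distance `η|y − y′|_∞` (`η = L^{−k}`) is
`K′`-Lipschitz for the coarser `ξ = L^{−j″}`-lattice distance, `j″ ≤ k` (`η = (L^{j″}η)·ξ`, `L^{j″}η ≤ 1`; p20's torus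
`lipschitz_rescale`). [cite: Balaban1983Higgs3, (3.23) p.439] -/
theorem lipschitz_eta_to_xi {ℓ j k : ℕ} (hjk : j ≤ k) {K' : ℝ} (hK' : 0 ≤ K') {g' : ZSite 3 → ℝ}
    (h : ∀ y y' : ZSite 3, |g' y' - g' y| ≤ K' * (xiOf ℓ k * (supNorm (y - y') : ℝ))) (y y' : ZSite 3) :
    |g' y' - g' y| ≤ K' * (xiOf ℓ j * (supNorm (y - y') : ℝ)) := by
  refine (h y y').trans (mul_le_mul_of_nonneg_left (mul_le_mul_of_nonneg_right ?_ (Nat.cast_nonneg _)) hK')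
  rw [xiOf_eq_scale_mul ℓ j k]
  exact mul_le_of_le_one_left (xiOf_pos ℓ j).le (scale330_le_one ℓ j k hjk)

/-- **THE VERTEX COEFFICIENT OF (3.23) ON THE `η`-LATTICE IS BOUNDED, UNIFORMLY IN `η`**: for the `η`-lattice propagator
`G^η_{j″}(0)` in both slots (`η = L^{−k}`, any `k ≥ j″ ≥ 1`), all `|g|,|g′| ≤ 1` with `g′` `K′`-Lipschitz for the `η`-distance,
every `μ` and `x`: `|[(3.23) on the η-lattice](x)| ≤ C₁ + C₂K′` with the constants of `exists_bracket323L_GxiL_bound`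
(rescaling sentence + the `ξ`-lattice bound). [cite: Balaban1983Higgs3, (3.23) p.439] -/
theorem exists_bracket323L_eta_bound {ℓ : ℕ} (hℓ : 1 ≤ ℓ) (amin aplus m2plus : ℝ) (ha : 0 < amin) :
    ∃ C₁ C₂ : ℝ, 0 < C₁ ∧ 0 < C₂ ∧ ∀ (j k : ℕ), 1 ≤ j → j ≤ k → ∀ (a m2 : ℝ), amin ≤ a → a ≤ aplus → 0 ≤ m2 →
      m2 ≤ m2plus → ∀ (K' : ℝ), 0 ≤ K' → ∀ (g g' : ZSite 3 → ℝ), (∀ x, |g x| ≤ 1) → (∀ x, |g' x| ≤ 1) →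
        (∀ y y' : ZSite 3, |g' y' - g' y| ≤ K' * (xiOf ℓ k * (supNorm (y - y') : ℝ))) →
        ∀ (μ : Fin 3) (x : ZSite 3),
          |bracket323L (xiOf ℓ k) μ (GetaL ℓ j k a m2) (GetaL ℓ j k a m2) g g' x| ≤ C₁ + C₂ * K' := by
  obtain ⟨C₁, C₂, hC₁, hC₂, h⟩ := exists_bracket323L_GxiL_bound hℓ amin aplus m2plus ha
  refine ⟨C₁, C₂, hC₁, hC₂, ?_⟩
  intro j k hj hjk a m2 ha1 ha2 hm1 hm2 K' hK' g g' hg hg' hlip μ x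
  have e := bracket323L_eta_eq ℓ j k a m2 (GxiL ℓ j a m2) g g' μ x
  rw [← GetaL_eq ℓ j k a m2] at e
  rw [e]
  exact (h j hj a m2 ha1 ha2 hm1 hm2 K' hK' g g' hg hg' (lipschitz_eta_to_xi hjk hK' hlip) μ x).2.2.2

end Rescale

/-! ## §8 *"We sum over proper orderings and j-indices and we get (3.23)"*: bilinearity, and (2.6) for `G_{j″}(0)` -/

section Resummation

variable {ι ι' : Type*}

/-- kernel: `∂^ξ_μ` of a finite sum of kernels. [cite: Balaban1983Higgs3, (3.23) p.439] -/
theorem dK1_finset_sum (s : Finset ι) (K : ι → ZSite 3 → ZSite 3 → ℝ) (ξ : ℝ) (μ : Fin 3) (y y' : ZSite 3) :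
    dK1 ξ μ (∑ i ∈ s, K i) y y' = ∑ i ∈ s, dK1 ξ μ (K i) y y' := by
  classical
  induction s using Finset.induction_on with
  | empty => simp [dK1]
  | insert i s hi ih =>
      rw [Finset.sum_insert hi, Finset.sum_insert hi, ← ih]
      simp only [dK1, Pi.add_apply]
      ring

/-- **(3.23) IS BILINEAR IN ITS TWO PROPAGATORS, SUMMAND BY SUMMAND**: for finite families of kernels the (3.23)-summand of
`(Σ_i K_i, Σ_{i′} K′_{i′})` is the double sum of the summands — the integrand-level content of *"we sum over proper orderings and
j-indices"*. [cite: Balaban1983Higgs3, (3.23) p.439] -/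
theorem term323_sum_sum (s : Finset ι) (t : Finset ι') (K : ι → ZSite 3 → ZSite 3 → ℝ)
    (K' : ι' → ZSite 3 → ZSite 3 → ℝ) (ξ : ℝ) (μ : Fin 3) (g g' : ZSite 3 → ℝ) (y y' : ZSite 3) :
    term323 ξ μ (∑ i ∈ s, K i) (∑ i' ∈ t, K' i') g g' y y' =
      ∑ i ∈ s, ∑ i' ∈ t, term323 ξ μ (K i) (K' i') g g' y y' := by
  simp only [term323, dK1_finset_sum, Finset.sum_apply, Finset.sum_mul, Finset.mul_sum]
  exact Finset.sum_comm

/-- **"WE SUM OVER PROPER ORDERINGS AND j-INDICES AND WE GET (3.23)"** — model-free on `ℤ³`: if every `(i, i′)` series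
converges, the square bracket of (3.23) for the summed propagators `(Σ_i K_i, Σ_{i′} K′_{i′})` is the double sum of the
brackets of the pieces. [cite: Balaban1983Higgs3, (3.23) p.439] -/
theorem bracket323L_sum_sum (s : Finset ι) (t : Finset ι') (K : ι → ZSite 3 → ZSite 3 → ℝ)
    (K' : ι' → ZSite 3 → ZSite 3 → ℝ) (ξ : ℝ) (μ : Fin 3) (g g' : ZSite 3 → ℝ) (y : ZSite 3)
    (hs : ∀ i ∈ s, ∀ i' ∈ t, Summable (term323 ξ μ (K i) (K' i') g g' y)) :
    bracket323L ξ μ (∑ i ∈ s, K i) (∑ i' ∈ t, K' i') g g' y =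
      ∑ i ∈ s, ∑ i' ∈ t, bracket323L ξ μ (K i) (K' i') g g' y := by
  simp only [bracket323L, term323_sum_sum]
  rw [Summable.tsum_finsetSum (fun i hi => summable_sum fun i' hi' => hs i hi i' hi')]
  exact Finset.sum_congr rfl fun i hi => Summable.tsum_finsetSum fun i' hi' => hs i hi i' hi'

/-- kernel: the first-variable difference of an exponentially decaying kernel decays exponentially:
`|K(p,q)| ≤ A·e^{−c|p−q|_∞}` for all `p, q` ⇒ `|(∂^ξ_μK)(y,y′)| ≤ ξ^{−1}·A(e^{c} + 1)·e^{−c|y−y′|_∞}`.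
[cite: Balaban1983Higgs3, (3.23) p.439] -/
theorem abs_dK1_le_of_exp {ξ c A : ℝ} (hξ : 0 < ξ) (hc : 0 ≤ c) {K : ZSite 3 → ZSite 3 → ℝ}
    (hK : ∀ p q, |K p q| ≤ A * Real.exp (-(c * (supNorm (p - q) : ℝ)))) (μ : Fin 3) (y y' : ZSite 3) :
    |dK1 ξ μ K y y'| ≤ ξ⁻¹ * (A * (Real.exp c + 1)) * Real.exp (-(c * (supNorm (y - y') : ℝ))) := by
  have hA : 0 ≤ A := by
    have h := (abs_nonneg _).trans (hK y y')
    exact le_of_mul_le_mul_right (by rwa [zero_mul]) (Real.exp_pos _)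
  have e1 : y + unitVec μ - y' = y - y' + unitVec μ := by abel
  have k1 := hK (y + unitVec μ) y'
  rw [e1] at k1
  have k2 := hK y y'
  obtain ⟨s1, -⟩ := exp_shift_le hc (y - y') μ
  have k1' : |K (y + unitVec μ) y'| ≤ A * (Real.exp c * Real.exp (-(c * (supNorm (y - y') : ℝ)))) :=
    k1.trans (mul_le_mul_of_nonneg_left s1 hA)
  unfold dK1
  rw [abs_mul, abs_of_pos (inv_pos.2 hξ)]
  calc ξ⁻¹ * |K (y + unitVec μ) y' - K y y'| ≤ ξ⁻¹ * (|K (y + unitVec μ) y'| + |K y y'|) :=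
        mul_le_mul_of_nonneg_left (abs_sub _ _) (inv_pos.2 hξ).le
    _ ≤ ξ⁻¹ * (A * (Real.exp c * Real.exp (-(c * (supNorm (y - y') : ℝ)))) +
          A * Real.exp (-(c * (supNorm (y - y') : ℝ)))) :=
        mul_le_mul_of_nonneg_left (add_le_add k1' k2) (inv_pos.2 hξ).le
    _ = ξ⁻¹ * (A * (Real.exp c + 1)) * Real.exp (-(c * (supNorm (y - y') : ℝ))) := by ring

/-- **THE (3.23)-SERIES CONVERGES FOR EXPONENTIALLY DECAYING KERNELS** (e.g. the scale pieces of (2.6), law (2.10)): if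
`|K(p,q)| ≤ A·e^{−c|p−q|_∞}` and `|K′(p,q)| ≤ A′·e^{−c′|p−q|_∞}` with `c, c′ > 0`, `|g|,|g′| ≤ 1`, then `y′ ↦ term323[K,K′](y,y′)`
is absolutely summable. [cite: Balaban1983Higgs3, (3.23) p.439] -/
theorem summable_term323_of_exp {ξ c c' A A' : ℝ} (hξ : 0 < ξ) (hc : 0 < c) (hc' : 0 < c')
    {K K' : ZSite 3 → ZSite 3 → ℝ} (hK : ∀ p q, |K p q| ≤ A * Real.exp (-(c * (supNorm (p - q) : ℝ))))
    (hK' : ∀ p q, |K' p q| ≤ A' * Real.exp (-(c' * (supNorm (p - q) : ℝ)))) {g g' : ZSite 3 → ℝ}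
    (hg : ∀ x, |g x| ≤ 1) (hg' : ∀ x, |g' x| ≤ 1) (μ : Fin 3) (y : ZSite 3) :
    Summable (term323 ξ μ K K' g g' y) := by
  have hA' : 0 ≤ A' := by
    have h := (abs_nonneg _).trans (hK' y y)
    exact le_of_mul_le_mul_right (by rwa [zero_mul]) (Real.exp_pos _)
  have hA : 0 ≤ A := by
    have h := (abs_nonneg _).trans (hK y y)
    exact le_of_mul_le_mul_right (by rwa [zero_mul]) (Real.exp_pos _)
  set D : ℝ := ξ⁻¹ * (A * (Real.exp c + 1)) * A' with hD
  have hD0 : 0 ≤ D := by positivity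
  obtain ⟨hsum, -, -⟩ := tsum_exp_supNorm_le (d := 3) rfl hc
  have hs0 : Summable fun y' : ZSite 3 => Real.exp (-(c * (supNorm (y - y') : ℝ))) := by
    have h := (Equiv.subLeft y).summable_iff.2 hsum
    refine h.congr fun y' => ?_
    simp only [Function.comp_apply, Equiv.subLeft_apply]
  have hs : Summable fun y' : ZSite 3 => ξ ^ 3 * (D * Real.exp (-(c * (supNorm (y - y') : ℝ)))) :=
    (hs0.mul_left D).mul_left (ξ ^ 3)
  refine Summable.of_norm_bounded hs fun y' => ?_
  rw [Real.norm_eq_abs]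
  have hd := abs_dK1_le_of_exp hξ hc.le hK μ y y'
  have hn : (0 : ℝ) ≤ (supNorm (y - y') : ℝ) := Nat.cast_nonneg _
  have hE1 : Real.exp (-(c' * (supNorm (y - y') : ℝ))) ≤ 1 := Real.exp_le_one_iff.2 (by nlinarith)
  have hK'1 : |K' y y'| ≤ A' := (hK' y y').trans ((mul_le_mul_of_nonneg_left hE1 hA').trans_eq (mul_one _))
  have hE : 0 ≤ ξ⁻¹ * (A * (Real.exp c + 1)) * Real.exp (-(c * (supNorm (y - y') : ℝ))) := by positivity
  have h12 : |dK1 ξ μ K y y'| * |g y| ≤ ξ⁻¹ * (A * (Real.exp c + 1)) * Real.exp (-(c * (supNorm (y - y') : ℝ))) * 1 :=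
    mul_le_mul hd (hg y) (abs_nonneg _) hE
  have h123 : |dK1 ξ μ K y y'| * |g y| * |K' y y'| ≤
      ξ⁻¹ * (A * (Real.exp c + 1)) * Real.exp (-(c * (supNorm (y - y') : ℝ))) * 1 * A' :=
    mul_le_mul h12 hK'1 (abs_nonneg _) (by rw [mul_one]; exact hE)
  have h1234 : |dK1 ξ μ K y y'| * |g y| * |K' y y'| * |g' y'| ≤
      ξ⁻¹ * (A * (Real.exp c + 1)) * Real.exp (-(c * (supNorm (y - y') : ℝ))) * 1 * A' * 1 :=
    mul_le_mul h123 (hg' y') (abs_nonneg _) (by rw [mul_one]; exact mul_nonneg hE hA')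
  unfold term323
  rw [abs_mul, abs_of_pos (pow_pos hξ 3), abs_mul, abs_mul, abs_mul]
  refine mul_le_mul_of_nonneg_left ?_ (pow_pos hξ 3).le
  calc |dK1 ξ μ K y y'| * |g y| * |K' y y'| * |g' y'|
      ≤ ξ⁻¹ * (A * (Real.exp c + 1)) * Real.exp (-(c * (supNorm (y - y') : ℝ))) * 1 * A' * 1 := h1234
    _ = D * Real.exp (-(c * (supNorm (y - y') : ℝ))) := by rw [hD]; ring

variable {ℓ k : ℕ} {a m2 : ℝ}

/-- **(3.23) FOR THE PRINT'S PROPAGATOR = THE SUM OVER `j, j′ < j″` OF THE BRACKETS OF THE PIECES**: with `G^ξ_{j″}(0) =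
Σ_{j<j″}G^ξ_{(j)}(0)` ((2.6), p39's `sum_pieceXi`) in BOTH slots (zero field), the square bracket of (3.23) equals `Σ_{j<j″}Σ_{j′<j″}`
of the brackets built from the pieces `(G^ξ_{(j)}(0), G^ξ_{(j′)}(0))` — every piece series converging by (2.10)
(`exists_pieceXi_exp`, `summable_term323_of_exp`) — *"we sum over proper orderings and j-indices and we get (3.23)"*, for every
`k = j″ ≥ 1`, `0 < a`, `0 ≤ m²`, `|g|,|g′| ≤ 1`, `μ`, `y`. [cite: Balaban1983Higgs3, (3.23) p.439] -/
theorem bracket323L_GxiL_eq_sum_pieces (hℓ : 1 ≤ ℓ) (hk : 1 ≤ k) (ha : 0 < a) (hm : 0 ≤ m2) {g g' : ZSite 3 → ℝ}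
    (hg : ∀ x, |g x| ≤ 1) (hg' : ∀ x, |g' x| ≤ 1) (μ : Fin 3) (y : ZSite 3) :
    bracket323L (xiOf ℓ k) μ (GxiL ℓ k a m2) (GxiL ℓ k a m2) g g' y =
      ∑ i ∈ Finset.range k, ∑ i' ∈ Finset.range k,
        bracket323L (xiOf ℓ k) μ (pieceXi ℓ k i a m2) (pieceXi ℓ k i' a m2) g g' y := by
  rw [← sum_pieceXi (ℓ := ℓ) (a := a) (m2 := m2) hk]
  refine bracket323L_sum_sum _ _ _ _ _ _ _ _ _ fun i hi i' hi' => ?_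
  obtain ⟨A, c, hc, hA⟩ := exists_pieceXi_exp hℓ hk ha hm (Finset.mem_range.1 hi)
  obtain ⟨A', c', hc', hA'⟩ := exists_pieceXi_exp hℓ hk ha hm (Finset.mem_range.1 hi')
  exact summable_term323_of_exp (xiOf_pos ℓ k) hc hc' hA hA' hg hg' μ y

end Resummation

/-! ## §9 *"Hence the last graph in (3.22) defines a vertex with some convergent function"* -/

section Vertex

variable {W : Type*} [NormedAddCommGroup W] [InnerProductSpace ℝ W]

/-- **THE EXPRESSION (3.23) IS A VERTEX WITH A BOUNDED COEFFICIENT** (model-free): if `|[bracket](μ,y)| ≤ B` for all `μ, y`,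
then for every leg `φ` supported in `S`, every `D` (in (3.23): `D_μ = ∂^ξ_μφ′`) and every charge matrix `q`,
`|(3.23)| ≤ B·Σ_μΣ_{y∈S} ξ³‖φ(y)‖·‖q²D_μ(y)‖`. [cite: Balaban1983Higgs3, (3.23) p.439] -/
theorem abs_expr323L_le {ξ B : ℝ} (hξ : 0 ≤ ξ) {q : W →ₗ[ℝ] W} {G0 G : ZSite 3 → ZSite 3 → ℝ} {g g' : ZSite 3 → ℝ}
    (hb : ∀ (μ : Fin 3) (y : ZSite 3), |bracket323L ξ μ G0 G g g' y| ≤ B)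
    (S : Finset (ZSite 3)) (φ : ZSite 3 → W) (D : Fin 3 → ZSite 3 → W) :
    |expr323L ξ q G0 G g g' S φ D| ≤ B * ∑ μ : Fin 3, ∑ y ∈ S, ξ ^ 3 * (‖φ y‖ * ‖q (q (D μ y))‖) := by
  unfold expr323L
  rw [Finset.mul_sum]
  refine (Finset.abs_sum_le_sum_abs _ _).trans (Finset.sum_le_sum fun μ _ => ?_)
  rw [Finset.mul_sum]
  refine (Finset.abs_sum_le_sum_abs _ _).trans (Finset.sum_le_sum fun y _ => ?_)
  rw [abs_mul, abs_of_nonneg (pow_nonneg hξ 3), abs_mul]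
  have h1 := hb μ y
  have h2 := abs_real_inner_le_norm (φ y) (q (q (D μ y)))
  have hB : 0 ≤ B := (abs_nonneg _).trans h1
  calc ξ ^ 3 * (|bracket323L ξ μ G0 G g g' y| * |⟪φ y, q (q (D μ y))⟫|)
      ≤ ξ ^ 3 * (B * (‖φ y‖ * ‖q (q (D μ y))‖)) :=
        mul_le_mul_of_nonneg_left (mul_le_mul h1 h2 (abs_nonneg _) hB) (pow_nonneg hξ 3)
    _ = B * (ξ ^ 3 * (‖φ y‖ * ‖q (q (D μ y))‖)) := by ring

/-- **(3.23) FOR THE PRINT'S PROPAGATOR, END OF THE p. 439 ANALYSIS — "HENCE THE LAST GRAPH IN (3.22) DEFINES A VERTEX WITH SOME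
CONVERGENT FUNCTION"**: there are `C₁, C₂ > 0` (on `L` and the window only) such that for every `k = j″ ≥ 1`, window point,
`K′ ≥ 0`, localizations `|g|,|g′| ≤ 1` with `g′` `K′`-Lipschitz, finite support `S`, leg `φ`, `D` and `q`:
`|(3.23)[G^ξ_{j″}(0), G^ξ_{j″}(0)]| ≤ (C₁ + C₂K′)·Σ_μΣ_{y∈S}ξ³‖φ(y)‖‖q²D_μ(y)‖` — the resummed last graph of (3.22) is a local
vertex with a bounded coefficient, ON THE PRINT'S CARRIER (the zero-field infinite lattice). [cite: Balaban1983Higgs3, (3.23) p.439] -/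
theorem exists_expr323L_GxiL_bound {ℓ : ℕ} (hℓ : 1 ≤ ℓ) (amin aplus m2plus : ℝ) (ha : 0 < amin) :
    ∃ C₁ C₂ : ℝ, 0 < C₁ ∧ 0 < C₂ ∧ ∀ (k : ℕ), 1 ≤ k → ∀ (a m2 : ℝ), amin ≤ a → a ≤ aplus → 0 ≤ m2 → m2 ≤ m2plus →
      ∀ (K' : ℝ), 0 ≤ K' → ∀ (g g' : ZSite 3 → ℝ), (∀ x, |g x| ≤ 1) → (∀ x, |g' x| ≤ 1) →
        (∀ y y' : ZSite 3, |g' y' - g' y| ≤ K' * (xiOf ℓ k * (supNorm (y - y') : ℝ))) →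
        ∀ (q : W →ₗ[ℝ] W) (S : Finset (ZSite 3)) (φ : ZSite 3 → W) (D : Fin 3 → ZSite 3 → W),
          |expr323L (xiOf ℓ k) q (GxiL ℓ k a m2) (GxiL ℓ k a m2) g g' S φ D| ≤
            (C₁ + C₂ * K') * ∑ μ : Fin 3, ∑ y ∈ S, (xiOf ℓ k) ^ 3 * (‖φ y‖ * ‖q (q (D μ y))‖) := by
  obtain ⟨C₁, C₂, hC₁, hC₂, h⟩ := exists_bracket323L_GxiL_bound hℓ amin aplus m2plus ha
  refine ⟨C₁, C₂, hC₁, hC₂, ?_⟩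
  intro k hk a m2 ha1 ha2 hm1 hm2 K' hK' g g' hg hg' hlip q S φ D
  exact abs_expr323L_le (xiOf_pos ℓ k).le
    (fun μ y => (h k hk a m2 ha1 ha2 hm1 hm2 K' hK' g g' hg hg' hlip μ y).2.2.2) S φ D

end Vertex

end

end Literature.MathematicalPhysics.QuantumFieldTheory.Balaban1983to89.B3Eq323ZeroLattice
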